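import Literature.Probability.RandomPlanarGeometry.HexSAWRotStripDictionary
import Literature.Probability.RandomPlanarGeometry.HexSAWHopfPath
import Literature.Probability.RandomPlanarGeometry.HexSAWLowerBound
import HarnessLib

/-!
# The exit classes of Beaton's rotated strip `D(H, W)` and Beaton 2014 Prop. 4 (the right-started strip identity)

Topic `Literature/Probability/RandomPlanarGeometry` (continues `HexSAWObservableRot.lean` (`HV.xi`, the rotated boundary sum
`HV.boundary_sum_rot`) and `HexSAWRotStripDictionary.lean` (`HV.xX`, `HV.rotStripV` = Beaton's `D(H,W)`, `HV.IsRotTopDart`);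
lane «pcv-sawmu», door R95 «HEX-BW-GM-ROT» of planner a-idea-1 g15, pieces K95.1-PREP-1…4 and the close/stub terms toward the face K95.1
«ROT-STRIP-IDENTITY» = Beaton's Proposition 4 in the tree's coordinates).  Source: N. R. Beaton, *The critical surface
fugacity of self-avoiding walks on a rotated honeycomb lattice*, J. Phys. A 47 (2014) 075003 (arXiv:1210.0274), §2.2
(the domain `D_{T,L}` and its boundary parts `α^{O±}, α^{I±}, ε^±, β^±`) and Proposition 4 (proof: "We would like the
winding angle of the reflection … of a walk to be the negative of that of the original walk … the adjusted winding angle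
`W*(γ) = W(γ) ± π/2`"); the Hopf argument is the tree's (`HexSAWHopf.lean`, `HexSAWHopfPath.lean`; Duminil-Copin–Smirnov
2012, proof of Lemma 2).  The class lemma for general `(H, W)` and the windings per class are not separate statements in
print (Beaton states their consequences through the coefficients of Proposition 4); the identity itself is.

Status in print: this file FORMALISES N. R. Beaton, J. Phys. A 47 (2014) 075003 = arXiv:1210.0274v3, §2.2, Proposition 4
(p. 5; proof pp. 5–7: adjusted winding W* = W ± π/2, the vertex set V′(D_{T,L}) = V ∖ {a⁻, a⁺}, the local identity (Lemma 3,
§2.1 p. 4, y = 1 case due to Smirnov) summed to S = 0, boundary coefficients −j·λ^{−5π/6}, j̄·λ^{−7π/6}, λ^{−π/2}/2, −j̄·λ^{−π/6}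
and mirrors, "multiplying by −4i") — the identity √(2−√(2−√2))·A^O_{T,L} + √(2−√(2+√2))·A^I_{T,L} + √(2+√(2−√2))·E_{T,L} +
√(2+√(2+√2))·B_{T,L} + 2√(4+2√2−√(2(10+7√2)))·P_{T,L} = √(8−4√2+2√(2(2−√2))) at x = x_c = 1/√(2+√2) — in the tree's
coordinates for the rotated strip D(H, W) and its RIGHT-started half (the printed identity is the sum of the two mirror
halves; coefficients appear here as 2cos(π/16) = √(2+√(2+√2)), 2cos(3π/16) = √(2+√(2−√2)), 2cos(5π/16) = 2sin(3π/16) =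
√(2−√(2−√2)), 2cos(7π/16) = 2sin(π/16) = √(2−√(2+√2)) halved, the polygon class weighted by x^{ℓ} with a⁻ uncounted so that
Beaton's P = x_c·rotGF(close) and his c_P = (4/x_c)cos(7π/16) = 2√(4+2√2−√(2(10+7√2))), right side K/2 with K = 4x_c cos(π/16)
= √(8−4√2+2√(2(2−√2))) — exact identities, lit-1 2026-08-23).  Printed and proved in print; first machine-checked text; class
CONSOLIDATION.  The corollary `rotStripBR_le_hexCriticalFugacity` (B^{→}_{H,W}(x_c) ≤ x_c, i.e. B_{T,L}(x_c) ≤ 2x_c with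
B_{T,L} = both halves) is the kernel form of Beaton's use of the identity with non-negative terms: "For 0 < y < y†, every term
in (the identity) is non-negative … A^O_{T,L}, A^I_{T,L}, B_{T,L} and P_{T,L} are increasing with L" (§4, p. 16) and "since
they are all bounded by this identity, it follows that they all have limits" (p. 17); cf. Duminil-Copin–Smirnov 2012 §3
"B_T^{x_c} ≤ 1" for the unrotated strip.  The novelty of the lane's R95 door lies downstream (the rotated-frame decay/tour
inequalities K95.4a «RotTourKeyIneq», the block inequality), not in this file.

## Contents (namespace `Literature.Probability.RandomPlanarGeometry.SAW.HV`)

* the five exit classes besides `IsRotTopDart`: `IsRotBotDart`, `IsRotBotIn` (α^I), `IsRotBotOut` (α^O), `IsRotLatDart` (ε),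
  `IsRotCloseDart` (arrival at `a⁻`), `IsRotStubDart` (the half-edge below `a⁺`) — texts of the planner's sketch, verbatim;
* `mem_rotStripV_iff` (the carrier box of `rotStripV` is implied by the three constraints), `xi_xX_adj`
  (`(Δξ, ΔX) ∈ {(0, ±2), (±1, ±1)}` along an edge), `xX_sub_three_emod`, `xX_ne_three`;
* **`rotStrip_exit_classes`** — for all `H, W ≥ 1` every half-edge out of `D(H,W) ∖ {a⁻}` is in one of the six classes;
  `rotStrip_classes_disjoint`, `not_mem_of_class`, **`rotStrip_exit_iff`**;
* the rotation lemma **`im_negI_mul_edir : Im(-I · edir y x) = -(3/2)(ξ x - ξ y)`** (multiplication by `-I` carries the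
  tree's picture to Beaton's: `ℓ` becomes the real axis, the domain the upper half-plane), `im_I_mul_edir`, `im_edir`,
  `negI_mul_edir_of_xi_eq`, the exit vectors `top_exit_vector` / `bot_exit_vector` / `lat_exit_vector`;
* the WINDINGS of right-started self-avoiding mid-walks of `D(H,W) ∖ {a⁻}` (Hopf, `hopf_path_eval` with `c₁ = -I`):
  **`pturn_of_isRotTopDart`** (`c₂ = -I`): `pturn = 2 / 1` (exit NW / NE; Beaton's `W* = W - π/2 = ±π/6`);
  **`pturn_of_isRotBotDart`** (`c₂ = +I`): `pturn = -2 / -1` right of `a`, `+6` left of `a` (`α^O`: `W* = ∓5π/6`,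
  `α^I`: `W* = ∓7π/6`); **`pturn_of_isRotLatDart`** (`c₂ = ±1`): `pturn = 0 / 3` (right / left line; `W* = ∓π/2`).
  **`pturn_of_isRotCloseDart`** (`c₂ = +I` on the sub-path from `a⁺`): `pturn = 5` for the walks closing a polygon
  through `a` at `a⁻` (`second_vertex_eq`, `last_vertex_eq_of_close`: such a walk runs `a⁻, a⁺, (-1,0,T), …, (0,-1,F), a⁻`);
* the BOUNDARY TERMS per class, `T(P) := edir(final) · λ^{pturn P} / e₀ · e^{-3πi/16}` (`rotPhase`, the common phase of the
  mirror pairs): `boundaryTerm_re_of_isRotTopDart : Re T = cos(π/16)`, `boundaryTerm_re_of_isRotLatDart : Re T = cos(3π/16)`,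
  `boundaryTerm_re_of_isRotBotOut : Re T = cos(5π/16)` (`= sin(3π/16)`), `boundaryTerm_re_of_isRotBotIn : Re T = cos(7π/16)`
  (`= sin(π/16)`) — Beaton's coefficients `c_B, c_E, c_O, c_I` of Proposition 4, halved (right-started walks only); with
  `emb_dirs_eq_lam_zpow` (the five exit directions as `λ⁸, λ¹⁶, λ²⁴, λ³², λ⁴⁰` times `e₀`) and `re_lam_zpow_mul_rotPhase`;
* the two `a`-local terms: `boundaryTerm_re_of_isRotCloseDart : Re T = cos(7π/16)` — on the WALK weight `x^ℓ` (Beaton's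
  `c_P = (2/x_c) cos(7π/16)` multiplies the polygon weight `x^{ℓ+1}`; this is the repaired close coefficient of record of the
  lane, the planner's first typed face having carried `c_P` onto `x^ℓ`), and `boundaryTerm_re_stub` (the walk `[a⁻, a⁺, (0,0,T)]`:
  `pturn = -1`, `Re T = cos(5π/16)`, weight `x_c`; it moves to the right-hand side: `cos(3π/16) - x_c cos(5π/16) = x_c cos(π/16)`).
* the ASSEMBLY (section `Assembly`): `rotGF V cls` (the right-started generating function of a dart class, text of the
  planner's sketch verbatim; `rotStripBR_eq_rotGF`), `boundary_sum_rot_re` (`Σ_{exits} x_c^ℓ Re T = cos(3π/16)` from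
  `HV.boundary_sum_rot`), `filter_isRotStubDart` (the stub class is the one walk `[a⁻, a⁺, (0,0,true)]`),
  `exitTerm_eq_classTerms` (one exit term sorted into its class), `two_mul_hexCriticalFugacity_mul_cos_pi_div_eight`;
  **`rotStrip_identity` / `rotStrip_identity_all`** — Beaton's Proposition 4 for `D(H,W)`, all `H, W ≥ 1`, right-started
  (the lane's face K95.1, token for token): `2 sin(3π/16) A^O + 2 sin(π/16) A^I + 2cos(3π/16) E + 2cos(π/16) B + 2cos(7π/16) P
  = 2 x_c cos(π/16)`; **`rotStripBR_le_hexCriticalFugacity`** — `B^{⊥,→}(H, W) ≤ x_c` for all `H, W ≥ 1`.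
-/

noncomputable section

namespace Literature.Probability.RandomPlanarGeometry.SAW

namespace HV

open Finset Real Complex

/-- `a⁻ ↦ X = 2`. [cite: Beaton2014RotatedHoneycomb, §2.2 (D_{T,L})] -/
theorem xX_wOut : xX wOut = 2 := by simp [xX, wOut]

/-! ### The five exit classes besides the top one (texts = planner a-idea-1 g15's `Sketch_G15_R95.lean` ed.5, verbatim;
`xi`, `xX`, `rotStripV`, `IsRotTopDart` are the tree's, from `HexSAWObservableRot` / `HexSAWRotStripDictionary`) -/


/-- bottom exit: from row 1 to an `ℓ`-vertex other than `a∓`. [cite: Beaton2014RotatedHoneycomb, §2.2 (α)] -/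
def IsRotBotDart (d : HV × HV) : Prop := xi d.1 = -1 ∧ xi d.2 = 0 ∧ d.2 ≠ hvOrigin ∧ d.2 ≠ wOut
/-- `α^I`: bottom exit heading TOWARD `a` (`a` sits at `xX = 3`). [cite: Beaton2014RotatedHoneycomb, §2.2] -/
def IsRotBotIn (d : HV × HV) : Prop := IsRotBotDart d ∧ |xX d.2 - 3| < |xX d.1 - 3|
/-- `α^O`: bottom exit heading AWAY from `a`. [cite: Beaton2014RotatedHoneycomb, §2.2] -/
def IsRotBotOut (d : HV × HV) : Prop := IsRotBotDart d ∧ |xX d.1 - 3| < |xX d.2 - 3|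
/-- `ε` in `D(H, W)`: a `Δξ = 0` edge through a lateral line `|xX - 3| = 3W`. [cite: Beaton2014RotatedHoneycomb, §2.2] -/
def IsRotLatDart (H Wd : ℕ) (d : HV × HV) : Prop :=
  xi d.2 = xi d.1 ∧ 1 ≤ -xi d.1 ∧ -xi d.1 ≤ H ∧ 3 * (Wd : ℤ) ≤ |xX d.2 - 3|
/-- `P`: closing the polygon through `a` (arriving at `a⁻ = wOut`; the immediate reversal `a⁺ → a⁻` is
not a mid-walk — `IsMidWalk`'s last clause — so it never contributes). [cite: Beaton2014RotatedHoneycomb, §2.2] -/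
def IsRotCloseDart (d : HV × HV) : Prop := d.2 = wOut
/-- the class-less external stub below `a⁺` (`ξ = +1`). [cite: Beaton2014RotatedHoneycomb, §2.2 (arXiv v3 p. 5)] -/
def IsRotStubDart (d : HV × HV) : Prop := d = (hvOrigin, ((0 : ℤ), (0 : ℤ), true))

/-- Decidability of the class predicate (the generating functions are `Finset.filter` sums). [folklore] -/
instance : DecidablePred IsRotBotDart := fun d => by unfold IsRotBotDart; infer_instance
/-- Decidability of the class predicate (the generating functions are `Finset.filter` sums). [folklore] -/
instance : DecidablePred IsRotBotIn := fun d => by unfold IsRotBotIn; infer_instance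
/-- Decidability of the class predicate (the generating functions are `Finset.filter` sums). [folklore] -/
instance : DecidablePred IsRotBotOut := fun d => by unfold IsRotBotOut; infer_instance
/-- Decidability of the lateral class predicate. [folklore] -/
instance (H Wd : ℕ) : DecidablePred (IsRotLatDart H Wd) := fun d => by unfold IsRotLatDart; infer_instance
/-- Decidability of the class predicate (the generating functions are `Finset.filter` sums). [folklore] -/
instance : DecidablePred IsRotCloseDart := fun d => by unfold IsRotCloseDart; infer_instance
/-- Decidability of the class predicate (the generating functions are `Finset.filter` sums). [folklore] -/
instance : DecidablePred IsRotStubDart := fun d => by unfold IsRotStubDart; infer_instance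

/-! ### The carrier box, edge arithmetic, and the classification -/

/-- **The carrier box of `rotStripV` is implied by the constraints**: membership in `D(H,W)` is
`v = a⁻ ∨ v = a⁺ ∨ (1 ≤ -ξ v ∧ -ξ v ≤ H ∧ |X v - 3| < 3W)`. [cite: Beaton2014RotatedHoneycomb, §2.2 (D_{T,L})] -/
theorem mem_rotStripV_iff {H Wd : ℕ} {v : HV} :
    v ∈ rotStripV H Wd ↔ v = wOut ∨ v = hvOrigin ∨ (1 ≤ -xi v ∧ -xi v ≤ H ∧ |xX v - 3| < 3 * Wd) := by
  obtain ⟨a, b, c⟩ := v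
  simp only [rotStripV, mem_insert, mem_filter, mem_product, mem_Icc, mem_univ, and_true]
  constructor
  · rintro (h | h | ⟨-, h⟩)
    · exact Or.inl h
    · exact Or.inr (Or.inl h)
    · exact Or.inr (Or.inr h)
  · rintro (h | h | h)
    · exact Or.inl h
    · exact Or.inr (Or.inl h)
    · refine Or.inr (Or.inr ⟨?_, h⟩)
      obtain ⟨h1, h2, h3⟩ := h
      cases c
      · simp only [xi, xX, bit_false, abs_lt] at h1 h2 h3 ⊢; omega
      · simp only [xi, xX, bit_true, abs_lt] at h1 h2 h3 ⊢; omega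

/-- Along an edge of `ℍ`, `(Δξ, ΔX) ∈ {(0, ±2), (+1, ∓1 …)}`: precisely, either `ξ` is unchanged and `X` changes by
`±2`, or `ξ` changes by `±1` and `X` changes by `±1`. [cite: Beaton2014RotatedHoneycomb, §2.2 (Fig. 3)] -/
theorem xi_xX_adj {u v : HV} (h : hvGraph.Adj u v) :
    (xi v = xi u ∧ (xX v = xX u + 2 ∨ xX v = xX u - 2)) ∨
      ((xi v = xi u + 1 ∨ xi v = xi u - 1) ∧ (xX v = xX u + 1 ∨ xX v = xX u - 1)) := by
  obtain ⟨a, b, c⟩ := u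
  obtain ⟨a', b', c'⟩ := v
  cases c <;> cases c' <;> simp [hvGraph_adj, AdjRel, xi, xX] at h ⊢ <;> omega

/-- `X - 3 = 3x₁ + b + 1` is never a multiple of `3`. [cite: Beaton2014RotatedHoneycomb, §2.2] -/
theorem xX_sub_three_emod (v : HV) : (xX v - 3) % 3 = 1 ∨ (xX v - 3) % 3 = 2 := by
  obtain ⟨a, b, c⟩ := v
  cases c
  · simp [xX]
  · simp [xX]; omega

/-- The vertices of `ℓ` with `X ∈ {2, 4}` are exactly `a∓`. [cite: Beaton2014RotatedHoneycomb, §2.2] -/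
theorem eq_wOut_or_hvOrigin_of_xi_xX {w : HV} (h0 : xi w = 0) (hX : xX w = 2 ∨ xX w = 4) :
    w = wOut ∨ w = hvOrigin := by
  obtain ⟨a, b, c⟩ := w
  cases c <;> simp [xi, xX, wOut, hvOrigin, Prod.ext_iff] at h0 hX ⊢ <;> omega

/-- `ξ` of the stub vertex below `a⁺`. [cite: Beaton2014RotatedHoneycomb, §2.2] -/
theorem xi_stub : xi ((0 : ℤ), (0 : ℤ), true) = 1 := by simp [xi]

/-- **Completeness of Beaton's exit classes for every `H, W ≥ 1`**: a half-edge from a vertex of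
`D(H,W) ∖ {a⁻}` to a lattice neighbour outside `D(H,W) ∖ {a⁻}` is bottom-in, bottom-out, lateral, top, the
closing half-edge at `a⁻`, or the stub below `a⁺`. (Sketch_G15_R95 checks `D(2,2)` and `D(3,1)` by `decide`;
this is the general statement.) [cite: Beaton2014RotatedHoneycomb, §2.2 (∂D_{T,L} = α^{O} ∪ α^{I} ∪ ε ∪ β, Fig. 3) and Proposition 4] -/
theorem rotStrip_exit_classes {H Wd : ℕ} (hH : 1 ≤ H) (hW : 1 ≤ Wd) {v w : HV}
    (hv : v ∈ (rotStripV H Wd).erase wOut) (hadj : hvGraph.Adj v w) (hw : w ∉ (rotStripV H Wd).erase wOut) :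
    IsRotBotIn (v, w) ∨ IsRotBotOut (v, w) ∨ IsRotLatDart H Wd (v, w) ∨ IsRotTopDart H (v, w) ∨
      IsRotCloseDart (v, w) ∨ IsRotStubDart (v, w) := by
  by_cases hwo : w = wOut
  · exact Or.inr (Or.inr (Or.inr (Or.inr (Or.inl hwo))))
  rw [mem_erase, mem_rotStripV_iff] at hv hw
  simp only [ne_eq, hwo, not_false_eq_true, true_and, false_or, not_or, not_and, not_lt] at hw
  obtain ⟨hwO, hwc⟩ := hw
  obtain ⟨hvne, rfl | rfl | ⟨hv1, hv2, hv3⟩⟩ := hv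
  · exact absurd rfl hvne
  · -- from `a⁺`: the three neighbours are `a⁻` (excluded), the stub `(0,0,true)`, and `(-1,0,true) ∈ D`
    obtain ⟨a, b, c⟩ := w
    have h := hadj
    cases c <;> simp [hvGraph_adj, AdjRel, hvOrigin] at h
    rcases h with ⟨rfl, rfl⟩ | ⟨rfl, rfl⟩ | ⟨rfl, rfl⟩
    · exact Or.inr (Or.inr (Or.inr (Or.inr (Or.inr rfl))))
    · exfalso
      have h3 := hwc (by simp [xi]) (by simp [xi]; omega)
      simp [xX] at h3
      omega
    · exact absurd rfl hwo
  · -- from an inner vertex with `1 ≤ -ξ v ≤ H`, `|X v - 3| < 3W`: only the four atoms `ξ v, X v, ξ w, X w` matter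
    rcases abs_cases (xX v - 3) with ⟨hq, hqs⟩ | ⟨hq, hqs⟩ <;>
    rcases abs_cases (xX w - 3) with ⟨hq', hqs'⟩ | ⟨hq', hqs'⟩ <;>
    rcases xX_sub_three_emod v with h3 | h3 <;>
    rcases xX_sub_three_emod w with h3' | h3' <;>
    rcases xi_xX_adj hadj with ⟨hξ, hX | hX⟩ | ⟨hξ | hξ, hX | hX⟩ <;>
    simp only [IsRotBotIn, IsRotBotOut, IsRotBotDart, IsRotLatDart, IsRotTopDart, ne_eq, hwO, hwo,
      not_false_eq_true, and_true, hq, hq'] at hwc hv3 ⊢ <;>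
    (by_cases h0 : xi w = 0
     · omega
     · by_cases h5 : -xi w ≤ (H : ℤ)
       · have h4 := hwc (by omega) h5
         omega
       · omega)

/-- **Exclusivity**: on darts `(v, w)` the six classes are pairwise disjoint whenever `H ≥ 1` (bottom /
lateral / top / stub are separated by the rows `ξ v`, `ξ w` alone, in and out by `X`, and the closing dart
ends at `a⁻`, which bottom darts exclude and which lies on `ℓ`). [cite: Beaton2014RotatedHoneycomb, §2.2] -/
theorem rotStrip_classes_disjoint {H Wd : ℕ} (hH : 1 ≤ H) (v w : HV) :
    (IsRotBotIn (v, w) → ¬ IsRotBotOut (v, w)) ∧ (IsRotBotDart (v, w) → ¬ IsRotLatDart H Wd (v, w)) ∧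
    (IsRotBotDart (v, w) → ¬ IsRotTopDart H (v, w)) ∧ (IsRotBotDart (v, w) → ¬ IsRotCloseDart (v, w)) ∧
    (IsRotBotDart (v, w) → ¬ IsRotStubDart (v, w)) ∧ (IsRotLatDart H Wd (v, w) → ¬ IsRotTopDart H (v, w)) ∧
    (IsRotLatDart H Wd (v, w) → ¬ IsRotCloseDart (v, w)) ∧ (IsRotLatDart H Wd (v, w) → ¬ IsRotStubDart (v, w)) ∧
    (IsRotTopDart H (v, w) → ¬ IsRotCloseDart (v, w)) ∧ (IsRotTopDart H (v, w) → ¬ IsRotStubDart (v, w)) ∧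
    (IsRotCloseDart (v, w) → ¬ IsRotStubDart (v, w)) := by
  have hstub : ∀ {v w : HV}, IsRotStubDart (v, w) → xi w = 1 := by
    intro v w h
    simp only [IsRotStubDart, Prod.mk.injEq] at h
    rw [h.2, xi_stub]
  have hclose : ∀ {v w : HV}, IsRotCloseDart (v, w) → xi w = 0 := by
    intro v w h
    simp only [IsRotCloseDart] at h
    rw [h, xi_wOut]
  refine ⟨?_, ?_, ?_, ?_, ?_, ?_, ?_, ?_, ?_, ?_, ?_⟩
  · rintro ⟨-, h1⟩ ⟨-, h2⟩; exact lt_asymm h1 h2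
  · rintro ⟨h1, h2, -, -⟩ ⟨h3, h4, -, -⟩; simp only at h1 h2 h3 h4; omega
  · rintro ⟨h1, h2, -, -⟩ ⟨h3, h4⟩; simp only at h1 h2 h3 h4; omega
  · rintro ⟨-, -, -, h2⟩ h; exact h2 h
  · rintro ⟨h1, h2, -, -⟩ h; have := hstub h; simp only at h2; omega
  · rintro ⟨h1, h2, -, -⟩ ⟨h3, h4⟩; simp only at h1 h2 h3 h4; omega
  · rintro ⟨h1, h2, -, -⟩ h; have := hclose h; simp only at h1 h2; omega
  · rintro ⟨h1, h2, -, -⟩ h; have := hstub h; simp only at h1 h2; omega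
  · rintro ⟨h1, h2⟩ h; have := hclose h; simp only at h1 h2; omega
  · rintro ⟨h1, h2⟩ h; have := hstub h; simp only at h1 h2; omega
  · intro h1 h2
    simp only [IsRotCloseDart, IsRotStubDart, Prod.mk.injEq] at h1 h2
    rw [h1] at h2
    exact absurd h2.2 (by decide)

/-- **Each class consists of exit darts**: if `(v, w)` is in one of the six classes (and `H, W ≥ 1`) then
`w ∉ D(H,W) ∖ {a⁻}`. [cite: Beaton2014RotatedHoneycomb, §2.2] -/
theorem not_mem_of_class {H Wd : ℕ} (hH : 1 ≤ H) {v w : HV}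
    (hcls : IsRotBotIn (v, w) ∨ IsRotBotOut (v, w) ∨ IsRotLatDart H Wd (v, w) ∨ IsRotTopDart H (v, w) ∨
      IsRotCloseDart (v, w) ∨ IsRotStubDart (v, w)) :
    w ∉ (rotStripV H Wd).erase wOut := by
  rw [mem_erase, mem_rotStripV_iff, not_and_or, not_or, not_or]
  rcases hcls with ⟨⟨-, h0, h1, h2⟩, -⟩ | ⟨⟨-, h0, h1, h2⟩, -⟩ | ⟨h4, h5, -, h3⟩ | ⟨-, h0⟩ | h | h
  · simp only at h0 h1 h2
    exact Or.inr ⟨h2, h1, fun h' => by omega⟩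
  · simp only at h0 h1 h2
    exact Or.inr ⟨h2, h1, fun h' => by omega⟩
  · simp only at h3 h4 h5
    refine Or.inr ⟨fun h => ?_, fun h => ?_, fun h' => by omega⟩
    · rw [h, xi_wOut] at h4; omega
    · rw [h, xi_hvOrigin] at h4; omega
  · simp only at h0
    refine Or.inr ⟨fun h => ?_, fun h => ?_, fun h' => by omega⟩
    · rw [h, xi_wOut] at h0; omega
    · rw [h, xi_hvOrigin] at h0; omega
  · left; simp only [IsRotCloseDart] at h; simp [h]
  · simp only [IsRotStubDart, Prod.mk.injEq] at h
    rw [h.2]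
    refine Or.inr ⟨by decide, by decide, fun h' => ?_⟩
    rw [xi_stub] at h'; omega

/-- **The exit condition is equivalent to membership in one of the six classes** (for darts out of a vertex
of `D(H,W) ∖ {a⁻}` along an edge of `ℍ`). [cite: Beaton2014RotatedHoneycomb, §2.2 and Proposition 4] -/
theorem rotStrip_exit_iff {H Wd : ℕ} (hH : 1 ≤ H) (hW : 1 ≤ Wd) {v w : HV}
    (hv : v ∈ (rotStripV H Wd).erase wOut) (hadj : hvGraph.Adj v w) :
    w ∉ (rotStripV H Wd).erase wOut ↔
      (IsRotBotIn (v, w) ∨ IsRotBotOut (v, w) ∨ IsRotLatDart H Wd (v, w) ∨ IsRotTopDart H (v, w) ∨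
        IsRotCloseDart (v, w) ∨ IsRotStubDart (v, w)) :=
  ⟨rotStrip_exit_classes hH hW hv hadj, not_mem_of_class hH⟩

/-- Sanity against the sketch's `decide` instances: the general lemma specialises to `D(2,2)`.
[cite: Beaton2014RotatedHoneycomb, §2.2] -/
example {v w : HV} (hv : v ∈ (rotStripV 2 2).erase wOut) (hadj : hvGraph.Adj v w)
    (hw : w ∉ (rotStripV 2 2).erase wOut) :
    IsRotBotIn (v, w) ∨ IsRotBotOut (v, w) ∨ IsRotLatDart 2 2 (v, w) ∨ IsRotTopDart 2 (v, w) ∨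
      IsRotCloseDart (v, w) ∨ IsRotStubDart (v, w) :=
  rotStrip_exit_classes (by norm_num) (by norm_num) hv hadj hw


/-! ### Windings of right-started walks to the boundary classes (Hopf with `c₁ = -I`) -/

/-- `ξ`-bounds of the vertices of `D(H,W)`: `-H ≤ ξ v ≤ 0`. [cite: Beaton2014RotatedHoneycomb, §2.2] -/
theorem xi_bounds_of_mem_rotStripV {H Wd : ℕ} {v : HV} (hv : v ∈ rotStripV H Wd) :
    -(H : ℤ) ≤ xi v ∧ xi v ≤ 0 := by
  simp only [rotStripV, mem_insert, mem_filter] at hv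
  rcases hv with rfl | rfl | ⟨-, h1, h2, -⟩
  · rw [xi_wOut]; omega
  · rw [xi_hvOrigin]; omega
  · omega

/-- The rotated height in the tree's `pos` frame: `2 (pos x).1 + (pos x).2 = 3 ξ x + 3`.
[cite: Beaton2014RotatedHoneycomb, §2 (Fig. 1(b))] -/
theorem two_mul_pos_fst_add_pos_snd (x : HV) : 2 * (pos x).1 + (pos x).2 = 3 * xi x + 3 := by
  obtain ⟨a, b, c⟩ := x
  cases c <;> simp [pos, xi] <;> ring

/-- `Im(-I · emb p) = -(p.1 + p.2/2)`. [folklore] -/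
private theorem im_negI_mul_emb (p : ℤ × ℤ) : (-I * emb p).im = -((p.1 : ℝ) + p.2 / 2) := by
  rw [neg_mul, Complex.neg_im, Complex.I_mul_im, emb_re]

/-- **The rotation `-I` carries the tree's picture to Beaton's**: `Im(-I · edir y x) = -(3/2)(ξ x - ξ y)`, so
"above the line through `y` parallel to `ℓ`" is "`ξ x ≤ ξ y`". [cite: Beaton2014RotatedHoneycomb, §2.2] -/
theorem im_negI_mul_edir (y x : HV) : (-I * edir y x).im = -(3 / 2 : ℝ) * (xi x - xi y) := by
  rw [edir, im_negI_mul_emb]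
  have hx := two_mul_pos_fst_add_pos_snd x
  have hy := two_mul_pos_fst_add_pos_snd y
  simp only [Prod.fst_sub, Prod.snd_sub, Int.cast_sub]
  have hx' : (2 : ℝ) * ((pos x).1 : ℝ) + ((pos x).2 : ℝ) = 3 * (xi x : ℝ) + 3 := by exact_mod_cast hx
  have hy' : (2 : ℝ) * ((pos y).1 : ℝ) + ((pos y).2 : ℝ) = 3 * (xi y : ℝ) + 3 := by exact_mod_cast hy
  linarith

/-- `-I · (-1 + 2ω) = √3` (the first dart `a⁻ → a⁺` becomes the positive real direction). [folklore] -/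
private theorem negI_mul_emb_neg_one_two : -I * emb (-1, 2) = (Real.sqrt 3 : ℂ) := by
  rw [emb_neg_one_two]
  ring_nf
  rw [Complex.I_sq]
  ring

/-- `-I · (-2 + ω) = √3 · ω` (exit from an up vertex: direction `π/3` in Beaton's frame). [folklore] -/
private theorem negI_mul_emb_neg_two_one : -I * emb (-2, 1) = (Real.sqrt 3 : ℂ) * omg := by
  apply Complex.ext
  · rw [Complex.mul_re, Complex.neg_re, Complex.neg_im, Complex.I_re, Complex.I_im, emb_re, emb_im,
      Complex.re_ofReal_mul, omg_re]
    push_cast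
    ring
  · rw [Complex.mul_im, Complex.neg_re, Complex.neg_im, Complex.I_re, Complex.I_im, emb_re, emb_im,
      Complex.im_ofReal_mul, omg_im]
    push_cast
    have h3 : Real.sqrt 3 * Real.sqrt 3 = 3 := Real.mul_self_sqrt (by norm_num)
    nlinarith [h3]

/-- `-I · (-1 - ω) = √3 · ω²` (exit from a down vertex: direction `2π/3` in Beaton's frame). [folklore] -/
private theorem negI_mul_emb_neg_one_neg_one : -I * emb (-1, -1) = (Real.sqrt 3 : ℂ) * omg ^ 2 := by
  rw [omg_sq]
  apply Complex.ext
  · rw [Complex.mul_re, Complex.neg_re, Complex.neg_im, Complex.I_re, Complex.I_im, emb_re, emb_im,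
      Complex.re_ofReal_mul, Complex.sub_re, omg_re, Complex.one_re]
    push_cast
    ring
  · rw [Complex.mul_im, Complex.neg_re, Complex.neg_im, Complex.I_re, Complex.I_im, emb_re, emb_im,
      Complex.im_ofReal_mul, Complex.sub_im, omg_im, Complex.one_im]
    push_cast
    have h3 : Real.sqrt 3 * Real.sqrt 3 = 3 := Real.mul_self_sqrt (by norm_num)
    nlinarith [h3]

/-- `arg(-I · (-1 + 2ω)) = 0`. [folklore] -/
private theorem arg_negI_mul_emb_neg_one_two : Complex.arg (-I * emb (-1, 2)) = 0 := by
  rw [negI_mul_emb_neg_one_two, Complex.arg_ofReal_of_nonneg (Real.sqrt_nonneg 3)]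

/-- `arg(-I · (-2 + ω)) = π/3`. [folklore] -/
private theorem arg_negI_mul_emb_neg_two_one : Complex.arg (-I * emb (-2, 1)) = π / 3 := by
  rw [negI_mul_emb_neg_two_one, Complex.arg_real_mul _ (by positivity), arg_omg]

/-- `arg(-I · (-1 - ω)) = 2π/3`. [folklore] -/
private theorem arg_negI_mul_emb_neg_one_neg_one : Complex.arg (-I * emb (-1, -1)) = 2 * π / 3 := by
  rw [negI_mul_emb_neg_one_neg_one, Complex.arg_real_mul _ (by positivity), arg_omg_sq]

/-- **The two top exit vectors**: if `ξ u = ξ v - 1` along an edge `v ∼ u` then `pos u - pos v = (-2, 1)` when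
`v` is an up vertex and `(-1, -1)` when `v` is a down vertex. [cite: Beaton2014RotatedHoneycomb, §2.2 (β^±)] -/
theorem top_exit_vector {v u : HV} (hadj : hvGraph.Adj v u) (hξ : xi u = xi v - 1) :
    pos u - pos v = if v.2.2 then (-1, -1) else (-2, 1) := by
  obtain ⟨a, b, c⟩ := v
  obtain ⟨a', b', c'⟩ := u
  cases c <;> cases c' <;> simp [hvGraph_adj, AdjRel, xi, pos, Prod.ext_iff] at hadj hξ ⊢ <;> omega

/-- **PREP-2: the winding to the top of Beaton's rotated strip.** For a right-started self-avoiding mid-walk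
`P` of `D(H, W) ∖ {a⁻}` (`H ≥ 1`) whose final half-edge is a top dart, the total turning is `pturn P = 2`
(`W = 2π/3`, exit heading NW from a down vertex) or `pturn P = 1` (`W = π/3`, exit heading NE from an up
vertex); in Beaton's adjusted normalisation `W* = W - π/2 = ±π/6`.  Hopf (`hopf_path_eval`) with
`c₁ = c₂ = -I`: both half-plane conditions are `-H-1 ≤ ξ ≤ 0` on the walk, the chord terms cancel, the first
dart has argument `0`. [cite: Beaton2014RotatedHoneycomb, Proposition 4 (proof; the windings to β^±); DuminilCopinSmirnov2012, proof of Lemma 2 (Hopf)] -/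
theorem pturn_of_isRotTopDart {H Wd : ℕ} (hH : 1 ≤ H) {P : List HV}
    (hP : IsMidWalk ((rotStripV H Wd).erase wOut) P) (htop : IsRotTopDart H (finalDart P)) :
    pturn P = if (finalDart P).1.2.2 then 2 else 1 := by
  rcases hP.trivial_or_exists with rfl | ⟨l, u, hl, rfl⟩
  · -- the trivial walk ends at `(a⁻, a⁺)`, which is not a top dart
    exfalso
    have h1 := htop.1
    simp only [finalDart, List.dropLast, List.getLast?_singleton, Option.getD_some, xi_wOut] at h1
    omega
  rw [finalDart_cons_append hl] at htop ⊢
  obtain ⟨h1, h2⟩ := htop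
  dsimp only at h1 h2 ⊢
  obtain ⟨-, hh, hadj, hlV, hnd, -⟩ := (isMidWalk_cons_append_iff _ hl u).1 hP
  set v := l.getLast hl with hv
  -- `ξ`-bounds along the walk: inner vertices in `[-H, 0]`, the exit vertex at `-H - 1`
  have hlξ : ∀ x ∈ l, -(H : ℤ) ≤ xi x ∧ xi x ≤ 0 := fun x hx =>
    xi_bounds_of_mem_rotStripV (mem_of_mem_erase (hlV x hx))
  have huξ : xi u = -(H : ℤ) - 1 := h2
  -- the list is duplicate-free
  have hwl : wOut ∉ l := fun h => (mem_erase.1 (hlV _ h)).1 rfl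
  have hul : u ∉ l := fun h => by have := (hlξ u h).1; omega
  have huw : u ≠ wOut := fun h => by rw [h, xi_wOut] at huξ; omega
  have hPnd : (wOut :: (l ++ [u])).Nodup := by
    rw [List.nodup_cons, List.mem_append, List.mem_singleton, not_or]
    exact ⟨⟨hwl, Ne.symm huw⟩, hnd.append (List.nodup_singleton u) (List.disjoint_singleton.2 hul)⟩
  have hlen : (wOut :: (l ++ [u])).length = l.length + 2 := by simp
  -- every entry of the walk has `-H - 1 ≤ ξ ≤ 0`
  have hentry : ∀ i ≤ l.length + 1, -(H : ℤ) - 1 ≤ xi ((wOut :: (l ++ [u])).getD i hvOrigin) ∧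
      xi ((wOut :: (l ++ [u])).getD i hvOrigin) ≤ 0 := by
    intro i hi
    rcases getD_walk_mem hi u with h | h | h
    · rw [h, xi_wOut]; omega
    · have := hlξ _ h; omega
    · rw [h, huξ]; omega
  have hI : (-I : ℂ) ≠ 0 := neg_ne_zero.2 Complex.I_ne_zero
  have e0 : edir wOut hvOrigin = emb (-1, 2) := by
    rw [edir, pos_hvOrigin, pos_wOut]; rfl
  have e1 : edir v u = emb (if v.2.2 then (-1, -1) else (-2, 1)) := by
    rw [edir, top_exit_vector hadj (by rw [huξ, h1])]
  have key := hopf_path_eval hP.1 hPnd hlen hI hI ?_ ?_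
  · -- evaluate: chord terms cancel, first dart has argument `0`, last dart `π/3` or `2π/3`
    rw [getD_walk_last, getD_walk_prev hl, List.getD_cons_zero, getD_walk_one hh, ← hv, e0, e1,
      arg_negI_mul_emb_neg_one_two] at key
    have hπ : (0 : ℝ) < π / 3 := by positivity
    by_cases hc : v.2.2
    · rw [if_pos hc] at key ⊢
      rw [arg_negI_mul_emb_neg_one_neg_one] at key
      have : (π / 3) * (pturn (wOut :: (l ++ [u])) : ℝ) = (π / 3) * 2 := by linarith
      exact_mod_cast mul_left_cancel₀ hπ.ne' this
    · rw [if_neg hc] at key ⊢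
      rw [arg_negI_mul_emb_neg_two_one] at key
      have : (π / 3) * (pturn (wOut :: (l ++ [u])) : ℝ) = (π / 3) * 1 := by linarith
      exact_mod_cast mul_left_cancel₀ hπ.ne' this
  · -- `h₁`: all entries satisfy `ξ ≤ 0 = ξ a⁻`
    intro i hi
    rw [List.getD_cons_zero, im_negI_mul_edir, xi_wOut]
    have := (hentry i hi).2
    have : (xi ((wOut :: (l ++ [u])).getD i hvOrigin) : ℝ) ≤ 0 := by exact_mod_cast this
    nlinarith
  · -- `h₂`: all entries satisfy `ξ ≥ -H - 1 = ξ u`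
    intro i hi
    rw [getD_walk_last, im_negI_mul_edir, huξ]
    have h := (hentry i hi).1
    have h' : ((-(H : ℤ) - 1 : ℤ) : ℝ) ≤ (xi ((wOut :: (l ++ [u])).getD i hvOrigin) : ℝ) := by
      exact_mod_cast h
    push_cast at h' ⊢
    nlinarith

/-! ### PREP-3: the windings to the bottom and to the lateral lines -/

/-- `|X v - 3| < 3W` for the vertices of `D(H,W)` (all of them: `a∓` have `X ∈ {2, 4}`).
[cite: Beaton2014RotatedHoneycomb, §2.2] -/
theorem abs_xX_sub_lt_of_mem_rotStripV {H Wd : ℕ} (hW : 1 ≤ Wd) {v : HV} (hv : v ∈ rotStripV H Wd) :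
    |xX v - 3| < 3 * Wd := by
  simp only [rotStripV, mem_insert, mem_filter] at hv
  rcases hv with rfl | rfl | ⟨-, -, -, h⟩
  · simp [xX, wOut]; omega
  · simp [xX, hvOrigin]; omega
  · exact h

/-- `X - 3` is the second `pos` coordinate: `(pos v).2 = xX v - 3`. [cite: Beaton2014RotatedHoneycomb, §2.2 (Fig. 3)] -/
theorem pos_snd_eq (v : HV) : (pos v).2 = xX v - 3 := by
  obtain ⟨a, b, c⟩ := v
  cases c <;> simp [pos, xX] <;> ring

/-- `X v ≠ 3` (`X - 3 = 3x₁ + b + 1` is never a multiple of `3`): no vertex sits on the axis of `a`.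
[cite: Beaton2014RotatedHoneycomb, §2.2] -/
theorem xX_ne_three (v : HV) : xX v ≠ 3 := by
  obtain ⟨a, b, c⟩ := v
  cases c <;> simp [xX] <;> omega

/-- `Re(-I · emb p) = p.2 · √3/2`. [folklore] -/
private theorem re_negI_mul_emb (p : ℤ × ℤ) : (-I * emb p).re = p.2 * (Real.sqrt 3 / 2) := by
  rw [neg_mul, Complex.neg_re, Complex.I_mul_re, emb_im, neg_neg]

/-- `Im(I · edir y x) = (3/2)(ξ x - ξ y)` (the rotation `+I`: the picture upside down). [folklore] -/
private theorem im_I_mul_edir (y x : HV) : (I * edir y x).im = (3 / 2 : ℝ) * (xi x - xi y) := by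
  have h := im_negI_mul_edir y x
  rw [neg_mul, Complex.neg_im] at h
  linarith

/-- `Im(edir y x) = ((pos x).2 - (pos y).2) · √3/2 = (X x - X y) · √3/2`. [folklore] -/
private theorem im_edir (y x : HV) : (edir y x).im = ((xX x : ℝ) - xX y) * (Real.sqrt 3 / 2) := by
  rw [edir, emb_im, Prod.snd_sub, pos_snd_eq, pos_snd_eq]
  push_cast
  ring

/-- A chord between two vertices of `ℓ` is vertical in the tree's frame: if `ξ u = ξ y` then
`-I · edir y u = ((X u - X y) √3/2 : ℝ)`. [cite: Beaton2014RotatedHoneycomb, §2.2] -/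
theorem negI_mul_edir_of_xi_eq {y u : HV} (h : xi u = xi y) :
    -I * edir y u = (((xX u : ℝ) - xX y) * (Real.sqrt 3 / 2) : ℝ) := by
  apply Complex.ext
  · rw [edir, re_negI_mul_emb, Complex.ofReal_re, Prod.snd_sub, pos_snd_eq, pos_snd_eq]
    push_cast; ring
  · rw [im_negI_mul_edir, Complex.ofReal_im, h, sub_self, mul_zero]

/-- **The two bottom exit vectors**: if `ξ u = ξ v + 1` along `v ∼ u` then `pos u - pos v = (1, 1)` (`v` up) or
`(2, -1)` (`v` down). [cite: Beaton2014RotatedHoneycomb, §2.2 (α)] -/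
theorem bot_exit_vector {v u : HV} (hadj : hvGraph.Adj v u) (hξ : xi u = xi v + 1) :
    pos u - pos v = if v.2.2 then (2, -1) else (1, 1) := by
  obtain ⟨a, b, c⟩ := v
  obtain ⟨a', b', c'⟩ := u
  cases c <;> cases c' <;> simp [hvGraph_adj, AdjRel, xi, pos, Prod.ext_iff] at hadj hξ ⊢ <;> omega

/-- **The two lateral exit vectors** (`Δξ = 0` edges are parallel to `a`): `pos u - pos v = (-1, 2)` (`X` increases,
`v` down) or `(1, -2)` (`X` decreases, `v` up). [cite: Beaton2014RotatedHoneycomb, §2.2 (ε)] -/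
theorem lat_exit_vector {v u : HV} (hadj : hvGraph.Adj v u) (hξ : xi u = xi v) :
    pos u - pos v = if v.2.2 then (-1, 2) else (1, -2) := by
  obtain ⟨a, b, c⟩ := v
  obtain ⟨a', b', c'⟩ := u
  cases c <;> cases c' <;> simp [hvGraph_adj, AdjRel, xi, pos, Prod.ext_iff] at hadj hξ ⊢ <;> omega

/-- `I · (1 + ω) = √3 · ω²` and `I · (2 - ω) = √3 · ω`: the bottom exit directions seen through `c₂ = +I`. [folklore] -/
private theorem I_mul_emb_one_one : I * emb (1, 1) = (Real.sqrt 3 : ℂ) * omg ^ 2 := by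
  rw [← negI_mul_emb_neg_one_neg_one, show ((-1 : ℤ), (-1 : ℤ)) = -((1 : ℤ), (1 : ℤ)) by simp, emb_neg]
  ring

/-- See `I_mul_emb_one_one`. [folklore] -/
private theorem I_mul_emb_two_neg_one : I * emb (2, -1) = (Real.sqrt 3 : ℂ) * omg := by
  rw [← negI_mul_emb_neg_two_one, show ((-2 : ℤ), (1 : ℤ)) = -((2 : ℤ), (-1 : ℤ)) by simp, emb_neg]
  ring

/-- **PREP-3a: the winding to the bottom of Beaton's rotated strip.** For a right-started self-avoiding
mid-walk `P` of `D(H,W) ∖ {a⁻}` (`H ≥ 1`) leaving through a BOTTOM dart `(v, u)` (`u ∈ ℓ ∖ {a∓}`): with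
`δ = -1` (exit SE, `v` up) or `-2` (exit SW, `v` down), `pturn P = δ` if `u` lies to the right of `a`
(`X u > 3`) and `pturn P = δ + 6` if to the left — i.e. `W ∈ {-π/3, -2π/3}` resp. `{5π/3, 4π/3}`; in
Beaton's classes: heading AWAY from `a` (`α^O`) `W* = W - π/2 = ∓5π/6`, heading TOWARD `a` (`α^I`)
`W* = ∓7π/6`.  Hopf with `c₁ = -I`, `c₂ = +I` (the exit vertex is lowest); the chord `a⁻u` lies in `ℓ`, so
`-I·D` is real and the chord terms give `0` or `-π`… i.e. `∓π` by side.
[cite: Beaton2014RotatedHoneycomb, Proposition 4 (proof; the windings to α^{O±}, α^{I±}); DuminilCopinSmirnov2012, proof of Lemma 2 (Hopf)] -/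
theorem pturn_of_isRotBotDart {H Wd : ℕ} {P : List HV}
    (hP : IsMidWalk ((rotStripV H Wd).erase wOut) P) (hbot : IsRotBotDart (finalDart P)) :
    pturn P = (if (finalDart P).1.2.2 then -2 else -1) + (if 3 < xX (finalDart P).2 then 0 else 6) := by
  rcases hP.trivial_or_exists with rfl | ⟨l, u, hl, rfl⟩
  · exfalso
    have h1 := hbot.2.2.1
    simp [finalDart, List.dropLast] at h1
  rw [finalDart_cons_append hl] at hbot ⊢
  obtain ⟨h1, h2, huO, huw⟩ := hbot
  dsimp only at h1 h2 huO huw ⊢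
  obtain ⟨-, hh, hadj, hlV, hnd, -⟩ := (isMidWalk_cons_append_iff _ hl u).1 hP
  set v := l.getLast hl with hv
  have hlξ : ∀ x ∈ l, -(H : ℤ) ≤ xi x ∧ xi x ≤ 0 := fun x hx =>
    xi_bounds_of_mem_rotStripV (mem_of_mem_erase (hlV x hx))
  have hwl : wOut ∉ l := fun h => (mem_erase.1 (hlV _ h)).1 rfl
  have hul : u ∉ l := by
    intro h
    have hm := (mem_erase.1 (hlV u h)).2
    simp only [rotStripV, mem_insert, mem_filter] at hm
    rcases hm with h' | h' | ⟨-, h', -, -⟩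
    · exact huw h'
    · exact huO h'
    · omega
  have hPnd : (wOut :: (l ++ [u])).Nodup := by
    rw [List.nodup_cons, List.mem_append, List.mem_singleton, not_or]
    exact ⟨⟨hwl, Ne.symm huw⟩, hnd.append (List.nodup_singleton u) (List.disjoint_singleton.2 hul)⟩
  have hlen : (wOut :: (l ++ [u])).length = l.length + 2 := by simp
  have hentry : ∀ i ≤ l.length + 1, -(H : ℤ) ≤ xi ((wOut :: (l ++ [u])).getD i hvOrigin) ∧
      xi ((wOut :: (l ++ [u])).getD i hvOrigin) ≤ 0 := by
    intro i hi
    rcases getD_walk_mem hi u with h | h | h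
    · rw [h, xi_wOut]; omega
    · exact hlξ _ h
    · rw [h, h2]; omega
  have hnI : (-I : ℂ) ≠ 0 := neg_ne_zero.2 Complex.I_ne_zero
  have hI : (I : ℂ) ≠ 0 := Complex.I_ne_zero
  have e0 : edir wOut hvOrigin = emb (-1, 2) := by rw [edir, pos_hvOrigin, pos_wOut]; rfl
  have e1 : edir v u = emb (if v.2.2 then (2, -1) else (1, 1)) := by
    rw [edir, bot_exit_vector hadj (by rw [h2, h1]; norm_num)]
  -- the chord `a⁻ → u` lies in `ℓ`: `-I·D = r` real, `r = (X u - 2)·√3/2 ≠ 0`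
  have hD : -I * edir wOut u = ((((xX u : ℝ) - 2) * (Real.sqrt 3 / 2) : ℝ) : ℂ) := by
    rw [negI_mul_edir_of_xi_eq (by rw [h2, xi_wOut])]
    simp [xX, wOut]
  have hD' : I * edir wOut u = ((-(((xX u : ℝ) - 2) * (Real.sqrt 3 / 2)) : ℝ) : ℂ) := by
    have : I * edir wOut u = -(-I * edir wOut u) := by ring
    rw [this, hD, ← Complex.ofReal_neg]
  have hX3 : xX u ≠ 3 := xX_ne_three u
  have hX2 : xX u ≠ 2 := by
    intro h
    obtain ⟨a, b, c⟩ := u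
    cases c <;> simp [xX, xi, wOut, Prod.ext_iff] at h h2 huw <;> omega
  have hX4 : xX u ≠ 4 := by
    intro h
    obtain ⟨a, b, c⟩ := u
    cases c <;> simp [xX, xi, hvOrigin, Prod.ext_iff] at h h2 huO <;> omega
  have hs3 : (0 : ℝ) < Real.sqrt 3 / 2 := by positivity
  have key := hopf_path_eval hP.1 hPnd hlen hnI hI ?_ ?_
  · rw [getD_walk_last, getD_walk_prev hl, List.getD_cons_zero, getD_walk_one hh, ← hv, e0, e1,
      arg_negI_mul_emb_neg_one_two, hD, hD'] at key
    have hπ : (0 : ℝ) < π / 3 := by positivity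
    by_cases hside : 3 < xX u
    · -- right of `a`: `r > 0`, `arg r = 0`, `arg (-r) = π`
      have h3r : (3 : ℝ) < xX u := by exact_mod_cast hside
      have hr : (0 : ℝ) < ((xX u : ℝ) - 2) * (Real.sqrt 3 / 2) := mul_pos (by linarith) hs3
      rw [Complex.arg_ofReal_of_nonneg hr.le, Complex.arg_ofReal_of_neg (by linarith)] at key
      rw [if_pos hside]
      by_cases hc : v.2.2
      · rw [if_pos hc] at key ⊢
        rw [I_mul_emb_two_neg_one, Complex.arg_real_mul _ (by positivity), arg_omg] at key
        have : (π / 3) * (pturn (wOut :: (l ++ [u])) : ℝ) = (π / 3) * (-2 : ℤ) := by push_cast; linarith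
        exact_mod_cast mul_left_cancel₀ hπ.ne' this
      · rw [if_neg hc] at key ⊢
        rw [I_mul_emb_one_one, Complex.arg_real_mul _ (by positivity), arg_omg_sq] at key
        have : (π / 3) * (pturn (wOut :: (l ++ [u])) : ℝ) = (π / 3) * (-1 : ℤ) := by push_cast; linarith
        exact_mod_cast mul_left_cancel₀ hπ.ne' this
    · -- left of `a`: `X u < 2`, `r < 0`
      have hlt : xX u < 2 := by omega
      have h2r : (xX u : ℝ) < 2 := by exact_mod_cast hlt
      have hr : ((xX u : ℝ) - 2) * (Real.sqrt 3 / 2) < 0 := mul_neg_of_neg_of_pos (by linarith) hs3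
      rw [Complex.arg_ofReal_of_neg hr, Complex.arg_ofReal_of_nonneg (by linarith)] at key
      rw [if_neg hside]
      by_cases hc : v.2.2
      · rw [if_pos hc] at key ⊢
        rw [I_mul_emb_two_neg_one, Complex.arg_real_mul _ (by positivity), arg_omg] at key
        have : (π / 3) * (pturn (wOut :: (l ++ [u])) : ℝ) = (π / 3) * ((-2 : ℤ) + 6 : ℤ) := by
          push_cast; linarith
        exact_mod_cast mul_left_cancel₀ hπ.ne' this
      · rw [if_neg hc] at key ⊢
        rw [I_mul_emb_one_one, Complex.arg_real_mul _ (by positivity), arg_omg_sq] at key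
        have : (π / 3) * (pturn (wOut :: (l ++ [u])) : ℝ) = (π / 3) * ((-1 : ℤ) + 6 : ℤ) := by
          push_cast; linarith
        exact_mod_cast mul_left_cancel₀ hπ.ne' this
  · intro i hi
    rw [List.getD_cons_zero, im_negI_mul_edir, xi_wOut]
    have := (hentry i hi).2
    have : (xi ((wOut :: (l ++ [u])).getD i hvOrigin) : ℝ) ≤ 0 := by exact_mod_cast this
    nlinarith
  · intro i hi
    rw [getD_walk_last, im_I_mul_edir, h2]
    have := (hentry i hi).2
    have : (xi ((wOut :: (l ++ [u])).getD i hvOrigin) : ℝ) ≤ 0 := by exact_mod_cast this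
    nlinarith

/-- **PREP-3b: the winding to the lateral lines of Beaton's rotated strip.** For a right-started
self-avoiding mid-walk `P` of `D(H,W) ∖ {a⁻}` (`H, W ≥ 1`) leaving through a LATERAL dart `(v, u)` (a `Δξ = 0`
edge crossing `|X - 3| = 3W`): `pturn P = 0` if it leaves through the right line (`X u > 3`) and `pturn P = 3`
(`W = π`) through the left line — Beaton's `W* = ∓π/2` for `ε^±`.  Hopf with `c₁ = -I` and `c₂ = +1` (right:
all walk abscissae `X ≤ X u`) resp. `c₂ = -1` (left); the chord contributes `∓π/2`.
[cite: Beaton2014RotatedHoneycomb, Proposition 4 (proof; the windings to ε^±); DuminilCopinSmirnov2012, proof of Lemma 2 (Hopf)] -/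
theorem pturn_of_isRotLatDart {H Wd : ℕ} (hW : 1 ≤ Wd) {P : List HV}
    (hP : IsMidWalk ((rotStripV H Wd).erase wOut) P) (hlat : IsRotLatDart H Wd (finalDart P)) :
    pturn P = if 3 < xX (finalDart P).2 then 0 else 3 := by
  rcases hP.trivial_or_exists with rfl | ⟨l, u, hl, rfl⟩
  · exfalso
    have h1 := hlat.2.1
    simp only [finalDart, List.dropLast, List.getLast?_singleton, Option.getD_some, xi_wOut] at h1
    omega
  rw [finalDart_cons_append hl] at hlat ⊢
  obtain ⟨h1, h2, h3, h4⟩ := hlat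
  dsimp only at h1 h2 h3 h4 ⊢
  obtain ⟨-, hh, hadj, hlV, hnd, -⟩ := (isMidWalk_cons_append_iff _ hl u).1 hP
  set v := l.getLast hl with hv
  have hlξ : ∀ x ∈ l, -(H : ℤ) ≤ xi x ∧ xi x ≤ 0 := fun x hx =>
    xi_bounds_of_mem_rotStripV (mem_of_mem_erase (hlV x hx))
  have hlX : ∀ x ∈ l, |xX x - 3| < 3 * Wd := fun x hx =>
    abs_xX_sub_lt_of_mem_rotStripV hW (mem_of_mem_erase (hlV x hx))
  have hwl : wOut ∉ l := fun h => (mem_erase.1 (hlV _ h)).1 rfl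
  have hul : u ∉ l := fun h => by have := hlX u h; omega
  have huw : u ≠ wOut := fun h => by rw [h, xi_wOut] at h1; omega
  have hPnd : (wOut :: (l ++ [u])).Nodup := by
    rw [List.nodup_cons, List.mem_append, List.mem_singleton, not_or]
    exact ⟨⟨hwl, Ne.symm huw⟩, hnd.append (List.nodup_singleton u) (List.disjoint_singleton.2 hul)⟩
  have hlen : (wOut :: (l ++ [u])).length = l.length + 2 := by simp
  have hentryξ : ∀ i ≤ l.length + 1, xi ((wOut :: (l ++ [u])).getD i hvOrigin) ≤ 0 := by
    intro i hi
    rcases getD_walk_mem hi u with h | h | h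
    · rw [h, xi_wOut]
    · exact (hlξ _ h).2
    · rw [h, h1]; omega
  have hentryX : ∀ i ≤ l.length + 1, |xX ((wOut :: (l ++ [u])).getD i hvOrigin) - 3| < 3 * Wd ∨
      (wOut :: (l ++ [u])).getD i hvOrigin = u := by
    intro i hi
    rcases getD_walk_mem hi u with h | h | h
    · left; rw [h]; simp [xX, wOut]; omega
    · exact Or.inl (hlX _ h)
    · exact Or.inr h
  have hnI : (-I : ℂ) ≠ 0 := neg_ne_zero.2 Complex.I_ne_zero
  have e0 : edir wOut hvOrigin = emb (-1, 2) := by rw [edir, pos_hvOrigin, pos_wOut]; rfl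
  have e1 : edir v u = emb (if v.2.2 then (-1, 2) else (1, -2)) := by
    rw [edir, lat_exit_vector hadj h1]
  -- the chord `z = -I·D`: `Im z = -(3/2) ξ u > 0`, `Re z = (X u - 2) √3/2`
  set z : ℂ := -I * edir wOut u with hz
  have hzim : 0 < z.im := by
    rw [hz, im_negI_mul_edir, xi_wOut]
    have : (xi u : ℝ) ≤ -1 := by exact_mod_cast (show xi u ≤ -1 by omega)
    nlinarith
  have hzre : z.re = ((xX u : ℝ) - 2) * (Real.sqrt 3 / 2) := by
    rw [hz, edir, re_negI_mul_emb, Prod.snd_sub, pos_snd_eq, pos_snd_eq]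
    simp [xX, wOut]; ring
  have hz0 : z ≠ 0 := fun h => by rw [h] at hzim; simp at hzim
  have hzarg : 0 ≤ Complex.arg z := Complex.arg_nonneg_iff.2 hzim.le
  have hDz : edir wOut u = I * z := by rw [hz]; ring_nf; rw [Complex.I_sq]; ring
  have hs3 : (0 : ℝ) < Real.sqrt 3 / 2 := by positivity
  have hπ : (0 : ℝ) < π / 3 := by positivity
  -- the orientation of the exit edge follows the side: `X` increases through the right line
  have hvX : |xX v - 3| < 3 * Wd := hlX _ (List.getLast_mem hl)
  have hΔX : xX u = (if v.2.2 then xX v + 2 else xX v - 2) := by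
    have := lat_exit_vector hadj h1
    have e := congrArg Prod.snd this
    rw [Prod.snd_sub, pos_snd_eq, pos_snd_eq] at e
    split_ifs at e ⊢ with hc <;> simp at e <;> omega
  by_cases hside : 3 < xX u
  · -- RIGHT line: `c₂ = 1`
    have hc : v.2.2 = true := by
      by_contra hc
      rw [if_neg hc] at hΔX
      rw [abs_lt] at hvX
      have h4' := h4
      rw [abs_of_pos (show (0 : ℤ) < xX u - 3 by omega)] at h4'
      omega
    have key := hopf_path_eval hP.1 hPnd hlen hnI one_ne_zero ?_ ?_
    · rw [getD_walk_last, getD_walk_prev hl, List.getD_cons_zero, getD_walk_one hh, ← hv, e0, e1,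
        arg_negI_mul_emb_neg_one_two, if_pos hc, one_mul, one_mul, emb_neg_one_two,
        Complex.arg_real_mul _ (by positivity), Complex.arg_I, ← hz, hDz] at key
      -- `arg (I z) = π/2 + arg z` (no wrap: `Re z ≥ 0`)
      have h3r : (3 : ℝ) < xX u := by exact_mod_cast hside
      have hre : 0 ≤ z.re := by rw [hzre]; exact mul_nonneg (by linarith) hs3.le
      have hcond : Complex.arg I + Complex.arg z ∈ Set.Ioc (-π) π := by
        rw [Complex.arg_I]
        have := Complex.arg_le_pi_div_two_iff.2 (Or.inl hre)
        constructor <;> linarith [Real.pi_pos]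
      have hIz : Complex.arg (I * z) = π / 2 + Complex.arg z := by
        rw [(Complex.arg_mul_eq_add_arg_iff Complex.I_ne_zero hz0).2 hcond, Complex.arg_I]
      rw [hIz] at key
      rw [if_pos hside]
      have : (π / 3) * (pturn (wOut :: (l ++ [u])) : ℝ) = (π / 3) * (0 : ℤ) := by push_cast; linarith
      exact_mod_cast mul_left_cancel₀ hπ.ne' this
    · intro i hi
      rw [List.getD_cons_zero, im_negI_mul_edir, xi_wOut]
      have := hentryξ i hi
      have : (xi ((wOut :: (l ++ [u])).getD i hvOrigin) : ℝ) ≤ 0 := by exact_mod_cast this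
      nlinarith
    · intro i hi
      rw [getD_walk_last, one_mul, im_edir]
      rcases hentryX i hi with h | h
      · have hx : (xX ((wOut :: (l ++ [u])).getD i hvOrigin) : ℝ) ≤ xX u := by
          have h4' := h4
          rw [abs_of_pos (show (0 : ℤ) < xX u - 3 by omega)] at h4'
          have := le_abs_self (xX ((wOut :: (l ++ [u])).getD i hvOrigin) - 3)
          have : xX ((wOut :: (l ++ [u])).getD i hvOrigin) ≤ xX u := by omega
          exact_mod_cast this
        nlinarith
      · rw [h, sub_self, zero_mul]
  · -- LEFT line: `c₂ = -1`
    have hlt : xX u < 3 := lt_of_le_of_ne (not_lt.1 hside) (xX_ne_three u)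
    have hc : ¬ v.2.2 = true := by
      intro hc
      rw [if_pos hc] at hΔX
      rw [abs_lt] at hvX
      have h4' := h4
      rw [abs_of_neg (show xX u - 3 < 0 by omega)] at h4'
      omega
    have key := hopf_path_eval hP.1 hPnd hlen hnI (neg_ne_zero.2 one_ne_zero) ?_ ?_
    · rw [getD_walk_last, getD_walk_prev hl, List.getD_cons_zero, getD_walk_one hh, ← hv, e0, e1,
        arg_negI_mul_emb_neg_one_two, if_neg hc, ← hz, hDz] at key
      have ht : (-1 : ℂ) * emb (1, -2) = (Real.sqrt 3 : ℂ) * I := by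
        rw [show ((1 : ℤ), (-2 : ℤ)) = -((-1 : ℤ), (2 : ℤ)) by simp, emb_neg, emb_neg_one_two]; ring
      have hmD : (-1 : ℂ) * (I * z) = -I * z := by ring
      rw [ht, Complex.arg_real_mul _ (by positivity), Complex.arg_I, hmD] at key
      -- `arg (-I z) = arg z - π/2` (no wrap since `arg z ≥ 0`)
      have hcond : Complex.arg (-I) + Complex.arg z ∈ Set.Ioc (-π) π := by
        rw [Complex.arg_neg_I]
        constructor <;> linarith [Real.pi_pos, Complex.arg_le_pi z]
      have hIz : Complex.arg (-I * z) = -(π / 2) + Complex.arg z := by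
        rw [(Complex.arg_mul_eq_add_arg_iff hnI hz0).2 hcond, Complex.arg_neg_I]
      rw [hIz] at key
      rw [if_neg hside]
      have : (π / 3) * (pturn (wOut :: (l ++ [u])) : ℝ) = (π / 3) * (3 : ℤ) := by push_cast; linarith
      exact_mod_cast mul_left_cancel₀ hπ.ne' this
    · intro i hi
      rw [List.getD_cons_zero, im_negI_mul_edir, xi_wOut]
      have := hentryξ i hi
      have : (xi ((wOut :: (l ++ [u])).getD i hvOrigin) : ℝ) ≤ 0 := by exact_mod_cast this
      nlinarith
    · intro i hi
      rw [getD_walk_last, neg_mul, one_mul, Complex.neg_im, im_edir]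
      rcases hentryX i hi with h | h
      · have hx : (xX u : ℝ) ≤ xX ((wOut :: (l ++ [u])).getD i hvOrigin) := by
          have h4' := h4
          rw [abs_of_neg (show xX u - 3 < 0 by omega)] at h4'
          have := neg_abs_le (xX ((wOut :: (l ++ [u])).getD i hvOrigin) - 3)
          have : xX u ≤ xX ((wOut :: (l ++ [u])).getD i hvOrigin) := by omega
          exact_mod_cast this
        nlinarith
      · rw [h, sub_self, zero_mul, neg_zero]

/-! ### Boundary terms per class (inputs for the assembly of Beaton's Proposition 4, right-started normalisation)

For a right-started walk `P` with final dart `(v, u)` put `T(P) := edir v u · λ^{pturn P} / e₀ · e^{-3πi/16}`, `e₀ = emb(-1,2)`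
the direction of `a⁻ → a⁺`, `λ = e^{-5πi/24}` the tree's winding weight (`σ = 5/8`); `e^{-3πi/16}` is the common phase of the
mirror pairs.  Then `Re T = cos(π/16)` (top), `cos(3π/16)` (lateral), `cos(5π/16) = sin(3π/16)` (`α^O`), `cos(7π/16) = sin(π/16)`
(`α^I`): Beaton's `c_B, c_E, c_O, c_I` halved. [cite: Beaton2014RotatedHoneycomb, Proposition 4] -/

/-- The normalising phase `e^{-3πi/16}`. [cite: Beaton2014RotatedHoneycomb, Proposition 4 (proof, adjusted winding)] -/
def rotPhase : ℂ := Complex.exp ((-(3 * π / 16) : ℝ) * I)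

/-- `Re(λ^n · e^{-3πi/16}) = cos(n θ₅ - 3π/16)`. [folklore] -/
private theorem re_lam_zpow_mul_rotPhase (n : ℤ) : (lam ^ n * rotPhase).re = Real.cos (n * θ₅ - 3 * π / 16) := by
  rw [lam_zpow, rotPhase, ← Complex.exp_add, ← add_mul, ← Complex.ofReal_add, Complex.exp_ofReal_mul_I_re]
  ring_nf

/-- `e₀ = emb(-1,2) ≠ 0`. [folklore] -/
private theorem emb_neg_one_two_ne_zero' : emb (-1, 2) ≠ 0 := by
  rw [Ne, emb_eq_zero_iff]; simp

/-- `λ¹⁶ = ω²`, `λ²⁴ = -1`, `λ³² = -ω`, `λ⁴⁰ = -ω²` (from `λ⁸ = ω`, `ω³ = -1`). [folklore] -/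
private theorem lam_zpow_multiples :
    lam ^ (16 : ℤ) = omg ^ 2 ∧ lam ^ (24 : ℤ) = -1 ∧ lam ^ (32 : ℤ) = -omg ∧ lam ^ (40 : ℤ) = -omg ^ 2 := by
  have h8 : lam ^ (8 : ℤ) = omg := lam_zpow_eight
  have h16 : lam ^ (16 : ℤ) = omg ^ 2 := by
    rw [show (16 : ℤ) = 8 + 8 by norm_num, zpow_add₀ lam_ne_zero, h8, sq]
  have h24 : lam ^ (24 : ℤ) = -1 := by
    rw [show (24 : ℤ) = 16 + 8 by norm_num, zpow_add₀ lam_ne_zero, h16, h8, ← pow_succ, omg_pow_three]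
  refine ⟨h16, h24, ?_, ?_⟩
  · rw [show (32 : ℤ) = 24 + 8 by norm_num, zpow_add₀ lam_ne_zero, h24, h8]; ring
  · rw [show (40 : ℤ) = 24 + 16 by norm_num, zpow_add₀ lam_ne_zero, h24, h16]; ring

/-- The five exit directions as `λ`-multiples of `e₀`: `emb(-2,1) = λ⁸e₀`, `emb(-1,-1) = λ¹⁶e₀`, `emb(1,-2) = λ²⁴e₀`,
`emb(2,-1) = λ³²e₀`, `emb(1,1) = λ⁴⁰e₀`. [folklore] -/
private theorem emb_dirs_eq_lam_zpow :
    emb (-2, 1) = lam ^ (8 : ℤ) * emb (-1, 2) ∧ emb (-1, -1) = lam ^ (16 : ℤ) * emb (-1, 2) ∧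
    emb (1, -2) = lam ^ (24 : ℤ) * emb (-1, 2) ∧ emb (2, -1) = lam ^ (32 : ℤ) * emb (-1, 2) ∧
    emb (1, 1) = lam ^ (40 : ℤ) * emb (-1, 2) := by
  obtain ⟨h16, h24, h32, h40⟩ := lam_zpow_multiples
  have e3 := omg_pow_three
  have e2 := omg_sq
  rw [lam_zpow_eight, h16, h24, h32, h40]
  simp only [emb]
  push_cast
  refine ⟨?_, ?_, ?_, ?_, ?_⟩
  · linear_combination (-2 : ℂ) * e2
  · linear_combination e2 - 2 * e3
  · ring
  · linear_combination (2 : ℂ) * e2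
  · linear_combination -e2 + 2 * e3

/-- The normalised boundary term with `edir = λ^a e₀` and `pturn = p` is `λ^{a+p} · e^{-3πi/16}`. [folklore] -/
private theorem boundaryTerm_eq {a p : ℤ} {d : ℂ} (hd : d = lam ^ a * emb (-1, 2)) :
    d * lam ^ p / emb (-1, 2) * rotPhase = lam ^ (a + p) * rotPhase := by
  rw [hd, zpow_add₀ lam_ne_zero]
  field_simp [emb_neg_one_two_ne_zero']

/-- **Top boundary term**: `Re T = cos(π/16)` (both sub-directions: `λ⁹` and `λ¹⁸`). [cite: Beaton2014RotatedHoneycomb, Proposition 4 (c_B = 2cos(π/16))] -/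
theorem boundaryTerm_re_of_isRotTopDart {H Wd : ℕ} (hH : 1 ≤ H) {P : List HV}
    (hP : IsMidWalk ((rotStripV H Wd).erase wOut) P) (htop : IsRotTopDart H (finalDart P)) :
    (edir (finalDart P).1 (finalDart P).2 * lam ^ pturn P / emb (-1, 2) * rotPhase).re = Real.cos (π / 16) := by
  have hpt := pturn_of_isRotTopDart hH hP htop
  rcases hP.trivial_or_exists with rfl | ⟨l, u, hl, rfl⟩
  · exfalso
    have h1 := htop.1
    simp only [finalDart, List.dropLast, List.getLast?_singleton, Option.getD_some, xi_wOut] at h1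
    omega
  rw [finalDart_cons_append hl] at htop hpt ⊢
  obtain ⟨h1, h2⟩ := htop
  dsimp only at h1 h2 hpt ⊢
  obtain ⟨-, -, hadj, -, -, -⟩ := (isMidWalk_cons_append_iff _ hl u).1 hP
  have hv := top_exit_vector hadj (by rw [h2, h1])
  obtain ⟨d8, d16, -, -, -⟩ := emb_dirs_eq_lam_zpow
  by_cases hc : (l.getLast hl).2.2
  · rw [if_pos hc] at hv hpt
    rw [hpt, boundaryTerm_eq (a := 16) (by rw [edir, hv, d16]), re_lam_zpow_mul_rotPhase,
      show (((16 + 2 : ℤ) : ℝ)) * θ₅ - 3 * π / 16 = π / 16 - ((2 : ℤ) : ℝ) * (2 * π) by rw [θ₅]; push_cast; ring,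
      Real.cos_sub_int_mul_two_pi]
  · rw [if_neg hc] at hv hpt
    rw [hpt, boundaryTerm_eq (a := 8) (by rw [edir, hv, d8]), re_lam_zpow_mul_rotPhase,
      show (((8 + 1 : ℤ) : ℝ)) * θ₅ - 3 * π / 16 = -(π / 16) - ((1 : ℤ) : ℝ) * (2 * π) by rw [θ₅]; push_cast; ring,
      Real.cos_sub_int_mul_two_pi, Real.cos_neg]

/-- **Lateral boundary term**: `Re T = cos(3π/16)` (`λ⁰` through the right line, `λ²⁷` through the left line).
[cite: Beaton2014RotatedHoneycomb, Proposition 4 (c_E = 2cos(3π/16))] -/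
theorem boundaryTerm_re_of_isRotLatDart {H Wd : ℕ} (hW : 1 ≤ Wd) {P : List HV}
    (hP : IsMidWalk ((rotStripV H Wd).erase wOut) P) (hlat : IsRotLatDart H Wd (finalDart P)) :
    (edir (finalDart P).1 (finalDart P).2 * lam ^ pturn P / emb (-1, 2) * rotPhase).re = Real.cos (3 * π / 16) := by
  have hpt := pturn_of_isRotLatDart hW hP hlat
  rcases hP.trivial_or_exists with rfl | ⟨l, u, hl, rfl⟩
  · exfalso
    have h1 := hlat.2.1
    simp only [finalDart, List.dropLast, List.getLast?_singleton, Option.getD_some, xi_wOut] at h1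
    omega
  rw [finalDart_cons_append hl] at hlat hpt ⊢
  obtain ⟨h1, h2, h3, h4⟩ := hlat
  dsimp only at h1 h2 h3 h4 hpt ⊢
  obtain ⟨-, -, hadj, hlV, -, -⟩ := (isMidWalk_cons_append_iff _ hl u).1 hP
  have hv := lat_exit_vector hadj h1
  have hvX : |xX (l.getLast hl) - 3| < 3 * Wd :=
    abs_xX_sub_lt_of_mem_rotStripV hW (mem_of_mem_erase (hlV _ (List.getLast_mem hl)))
  have hΔX : xX u = (if (l.getLast hl).2.2 then xX (l.getLast hl) + 2 else xX (l.getLast hl) - 2) := by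
    have e := congrArg Prod.snd hv
    rw [Prod.snd_sub, pos_snd_eq, pos_snd_eq] at e
    split_ifs at e ⊢ <;> simp at e <;> omega
  obtain ⟨-, -, d24, -, -⟩ := emb_dirs_eq_lam_zpow
  by_cases hside : 3 < xX u
  · have hc : (l.getLast hl).2.2 = true := by
      by_contra hc
      rw [if_neg hc] at hΔX; rw [abs_lt] at hvX
      have h4' := h4; rw [abs_of_pos (show (0 : ℤ) < xX u - 3 by omega)] at h4'; omega
    rw [if_pos hside] at hpt
    rw [if_pos hc] at hv
    rw [hpt, boundaryTerm_eq (a := 0) (by rw [edir, hv, zpow_zero, one_mul]), re_lam_zpow_mul_rotPhase,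
      show (((0 + 0 : ℤ) : ℝ)) * θ₅ - 3 * π / 16 = -(3 * π / 16) by push_cast; ring, Real.cos_neg]
  · have hlt : xX u < 3 := lt_of_le_of_ne (not_lt.1 hside) (xX_ne_three u)
    have hc : ¬ (l.getLast hl).2.2 = true := by
      intro hc
      rw [if_pos hc] at hΔX; rw [abs_lt] at hvX
      have h4' := h4; rw [abs_of_neg (show xX u - 3 < 0 by omega)] at h4'; omega
    rw [if_neg hside] at hpt
    rw [if_neg hc] at hv
    rw [hpt, boundaryTerm_eq (a := 24) (by rw [edir, hv, d24]), re_lam_zpow_mul_rotPhase,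
      show (((24 + 3 : ℤ) : ℝ)) * θ₅ - 3 * π / 16 = 3 * π / 16 - ((3 : ℤ) : ℝ) * (2 * π) by rw [θ₅]; push_cast; ring,
      Real.cos_sub_int_mul_two_pi]

/-- **Bottom-out boundary term (`α^O`, heading away from `a`)**: `Re T = cos(5π/16) = sin(3π/16)` (`λ³⁹` right of `a`,
`λ³⁶` left of `a`). [cite: Beaton2014RotatedHoneycomb, Proposition 4 (c_O = 2sin(3π/16))] -/
theorem boundaryTerm_re_of_isRotBotOut {H Wd : ℕ} {P : List HV}
    (hP : IsMidWalk ((rotStripV H Wd).erase wOut) P) (hout : IsRotBotOut (finalDart P)) :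
    (edir (finalDart P).1 (finalDart P).2 * lam ^ pturn P / emb (-1, 2) * rotPhase).re = Real.cos (5 * π / 16) := by
  have hpt := pturn_of_isRotBotDart hP hout.1
  rcases hP.trivial_or_exists with rfl | ⟨l, u, hl, rfl⟩
  · exfalso
    have h1 := hout.1.2.2.1
    simp [finalDart, List.dropLast] at h1
  rw [finalDart_cons_append hl] at hout hpt ⊢
  obtain ⟨⟨h1, h2, -, -⟩, hio⟩ := hout
  dsimp only at h1 h2 hio hpt ⊢
  obtain ⟨-, -, hadj, -, -, -⟩ := (isMidWalk_cons_append_iff _ hl u).1 hP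
  have hv := bot_exit_vector hadj (by rw [h2, h1]; norm_num)
  have hΔX : xX u = (if (l.getLast hl).2.2 then xX (l.getLast hl) - 1 else xX (l.getLast hl) + 1) := by
    have e := congrArg Prod.snd hv
    rw [Prod.snd_sub, pos_snd_eq, pos_snd_eq] at e
    split_ifs at e ⊢ <;> simp at e <;> omega
  have hX3 := xX_ne_three u
  obtain ⟨-, -, -, d32, d40⟩ := emb_dirs_eq_lam_zpow
  by_cases hc : (l.getLast hl).2.2
  · -- `v` down: `X` decreases; heading away means left of `a`
    rw [if_pos hc] at hv hpt hΔX
    have hside : ¬ 3 < xX u := by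
      intro hs
      rw [hΔX] at hio hs
      rcases abs_cases (xX (l.getLast hl) - 3) with ⟨ha, _⟩ | ⟨ha, _⟩ <;>
        rcases abs_cases (xX (l.getLast hl) - 1 - 3) with ⟨hb, _⟩ | ⟨hb, _⟩ <;> omega
    rw [if_neg hside] at hpt
    rw [hpt, boundaryTerm_eq (a := 32) (by rw [edir, hv, d32]), re_lam_zpow_mul_rotPhase,
      show (((32 + (-2 + 6) : ℤ) : ℝ)) * θ₅ - 3 * π / 16 = 5 * π / 16 - ((4 : ℤ) : ℝ) * (2 * π) by
        rw [θ₅]; push_cast; ring, Real.cos_sub_int_mul_two_pi]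
  · -- `v` up: `X` increases; heading away means right of `a`
    rw [if_neg hc] at hv hpt hΔX
    have hside : 3 < xX u := by
      by_contra hs
      rw [hΔX] at hio hs
      rcases abs_cases (xX (l.getLast hl) - 3) with ⟨ha, _⟩ | ⟨ha, _⟩ <;>
        rcases abs_cases (xX (l.getLast hl) + 1 - 3) with ⟨hb, _⟩ | ⟨hb, _⟩ <;> omega
    rw [if_pos hside] at hpt
    rw [hpt, boundaryTerm_eq (a := 40) (by rw [edir, hv, d40]), re_lam_zpow_mul_rotPhase,
      show (((40 + (-1 + 0) : ℤ) : ℝ)) * θ₅ - 3 * π / 16 = -(5 * π / 16) - ((4 : ℤ) : ℝ) * (2 * π) by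
        rw [θ₅]; push_cast; ring, Real.cos_sub_int_mul_two_pi, Real.cos_neg]

/-- **Bottom-in boundary term (`α^I`, heading toward `a`)**: `Re T = cos(7π/16) = sin(π/16)` (`λ³⁰` right of `a`,
`λ⁴⁵` left of `a`). [cite: Beaton2014RotatedHoneycomb, Proposition 4 (c_I = 2sin(π/16))] -/
theorem boundaryTerm_re_of_isRotBotIn {H Wd : ℕ} {P : List HV}
    (hP : IsMidWalk ((rotStripV H Wd).erase wOut) P) (hin : IsRotBotIn (finalDart P)) :
    (edir (finalDart P).1 (finalDart P).2 * lam ^ pturn P / emb (-1, 2) * rotPhase).re = Real.cos (7 * π / 16) := by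
  have hpt := pturn_of_isRotBotDart hP hin.1
  rcases hP.trivial_or_exists with rfl | ⟨l, u, hl, rfl⟩
  · exfalso
    have h1 := hin.1.2.2.1
    simp [finalDart, List.dropLast] at h1
  rw [finalDart_cons_append hl] at hin hpt ⊢
  obtain ⟨⟨h1, h2, -, -⟩, hio⟩ := hin
  dsimp only at h1 h2 hio hpt ⊢
  obtain ⟨-, -, hadj, -, -, -⟩ := (isMidWalk_cons_append_iff _ hl u).1 hP
  have hv := bot_exit_vector hadj (by rw [h2, h1]; norm_num)
  have hΔX : xX u = (if (l.getLast hl).2.2 then xX (l.getLast hl) - 1 else xX (l.getLast hl) + 1) := by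
    have e := congrArg Prod.snd hv
    rw [Prod.snd_sub, pos_snd_eq, pos_snd_eq] at e
    split_ifs at e ⊢ <;> simp at e <;> omega
  have hX3 := xX_ne_three u
  obtain ⟨-, -, -, d32, d40⟩ := emb_dirs_eq_lam_zpow
  by_cases hc : (l.getLast hl).2.2
  · -- `v` down: `X` decreases; heading toward `a` means right of `a`
    rw [if_pos hc] at hv hpt hΔX
    have hside : 3 < xX u := by
      by_contra hs
      rw [hΔX] at hio hs
      rcases abs_cases (xX (l.getLast hl) - 3) with ⟨ha, _⟩ | ⟨ha, _⟩ <;>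
        rcases abs_cases (xX (l.getLast hl) - 1 - 3) with ⟨hb, _⟩ | ⟨hb, _⟩ <;> omega
    rw [if_pos hside] at hpt
    rw [hpt, boundaryTerm_eq (a := 32) (by rw [edir, hv, d32]), re_lam_zpow_mul_rotPhase,
      show (((32 + (-2 + 0) : ℤ) : ℝ)) * θ₅ - 3 * π / 16 = -(7 * π / 16) - ((3 : ℤ) : ℝ) * (2 * π) by
        rw [θ₅]; push_cast; ring, Real.cos_sub_int_mul_two_pi, Real.cos_neg]
  · -- `v` up: `X` increases; heading toward `a` means left of `a`
    rw [if_neg hc] at hv hpt hΔX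
    have hside : ¬ 3 < xX u := by
      intro hs
      rw [hΔX] at hio hs
      rcases abs_cases (xX (l.getLast hl) - 3) with ⟨ha, _⟩ | ⟨ha, _⟩ <;>
        rcases abs_cases (xX (l.getLast hl) + 1 - 3) with ⟨hb, _⟩ | ⟨hb, _⟩ <;> omega
    rw [if_neg hside] at hpt
    rw [hpt, boundaryTerm_eq (a := 40) (by rw [edir, hv, d40]), re_lam_zpow_mul_rotPhase,
      show (((40 + (-1 + 6) : ℤ) : ℝ)) * θ₅ - 3 * π / 16 = 7 * π / 16 - ((5 : ℤ) : ℝ) * (2 * π) by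
        rw [θ₅]; push_cast; ring, Real.cos_sub_int_mul_two_pi]

/-! ### The two `a`-local classes: closing at `a⁻` (polygons through `a`) and the stub below `a⁺` -/

/-- The only upper neighbour of `a⁺`: a right-started walk of `D(H,W) ∖ {a⁻}` continues from `a⁺` to `(-1, 0, true)`.
[cite: Beaton2014RotatedHoneycomb, §2.2 (the vertices a∓)] -/
theorem second_vertex_eq {H Wd : ℕ} {l : List HV} {u : HV} (hl : l ≠ [])
    (hP : IsMidWalk ((rotStripV H Wd).erase wOut) (wOut :: (l ++ [u]))) (h2 : 2 ≤ l.length) :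
    l[1]'(by omega) = ((-1 : ℤ), (0 : ℤ), true) := by
  obtain ⟨hc, hh, -, hlV, -, -⟩ := (isMidWalk_cons_append_iff _ hl u).1 hP
  have h0 : l[0]'(by omega) = hvOrigin := by
    cases l with
    | nil => exact absurd rfl hl
    | cons a t => simpa using hh
  have hadj : hvGraph.Adj (l[0]'(by omega)) (l[1]'(by omega)) := hc.getElem 0 (by omega)
  rw [h0] at hadj
  have hmem : l[1]'(by omega) ∈ (rotStripV H Wd).erase wOut := hlV _ (List.getElem_mem _)
  rw [mem_erase, mem_rotStripV_iff] at hmem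
  obtain ⟨hne, h⟩ := hmem
  generalize l[1]'(by omega) = x at hadj hne h ⊢
  obtain ⟨a, b, c⟩ := x
  cases c <;> simp [hvGraph_adj, AdjRel, hvOrigin] at hadj
  rcases hadj with ⟨ha, hb⟩ | ⟨ha, hb⟩ | ⟨ha, hb⟩
  · -- the stub vertex `(0,0,true)` is not in `D(H,W)`
    exfalso
    obtain rfl : a = 0 := by omega
    obtain rfl : b = 0 := by omega
    rcases h with h | h | ⟨h, -, -⟩
    · simp [wOut] at h
    · simp [hvOrigin] at h
    · simp [xi] at h
  · obtain rfl : a = -1 := by omega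
    obtain rfl : b = 0 := by omega
    rfl
  · exfalso
    obtain rfl : a = 0 := by omega
    obtain rfl : b = -1 := by omega
    exact hne rfl

/-- The only upper neighbour of `a⁻` other than `a⁺`: a right-started self-avoiding walk of `D(H,W) ∖ {a⁻}`
arriving at `a⁻` comes from `(0, -1, false)`. [cite: Beaton2014RotatedHoneycomb, §2.2 (the vertices a∓)] -/
theorem last_vertex_eq_of_close {H Wd : ℕ} {l : List HV} (hl : l ≠ [])
    (hP : IsMidWalk ((rotStripV H Wd).erase wOut) (wOut :: (l ++ [wOut]))) :
    l.getLast hl = ((0 : ℤ), (-1 : ℤ), false) := by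
  obtain ⟨-, hh, hadj, hlV, hnd, hne⟩ := (isMidWalk_cons_append_iff _ hl wOut).1 hP
  have hmem : l.getLast hl ∈ (rotStripV H Wd).erase wOut := hlV _ (List.getLast_mem hl)
  rw [mem_erase, mem_rotStripV_iff] at hmem
  obtain ⟨hnw, h⟩ := hmem
  -- the last inner vertex is not `a⁺`: otherwise `l = [a⁺]` by self-avoidance and the walk would reverse `a`
  have hvO : l.getLast hl ≠ hvOrigin := by
    intro hvO
    have h0 : l[0]'(List.length_pos_of_ne_nil hl) = hvOrigin := by
      cases l with
      | nil => exact absurd rfl hl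
      | cons a t => simpa using hh
    have hlast : l[l.length - 1]'(by have := List.length_pos_of_ne_nil hl; omega) = hvOrigin := by
      rw [← hvO, List.getLast_eq_getElem]
    have hlen : l.length - 1 = 0 := (List.Nodup.getElem_inj_iff hnd).1 (hlast.trans h0.symm)
    apply hne
    cases l with
    | nil => exact absurd rfl hl
    | cons a t =>
      have ht : t = [] := List.eq_nil_of_length_eq_zero (by simpa using hlen)
      subst ht
      simp only [List.head?_cons, Option.some.injEq] at hh
      subst hh
      rfl
  generalize l.getLast hl = x at hadj hnw h hvO ⊢
  obtain ⟨a, b, c⟩ := x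
  cases c <;> simp [hvGraph_adj, AdjRel, wOut] at hadj
  rcases hadj with ⟨ha, hb⟩ | ⟨ha, hb⟩ | ⟨ha, hb⟩
  · obtain rfl : a = 0 := by omega
    obtain rfl : b = -1 := by omega
    rfl
  · -- `(1,-1,false)` has `ξ = 1`, outside `D(H,W)`
    exfalso
    obtain rfl : a = 1 := by omega
    obtain rfl : b = -1 := by omega
    rcases h with h | h | ⟨h, -, -⟩
    · simp [wOut] at h
    · simp [hvOrigin] at h
    · simp [xi] at h
  · exfalso
    obtain rfl : a = 0 := by omega
    obtain rfl : b = 0 := by omega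
    exact hvO rfl

/-- **The winding of a closing walk** (a self-avoiding polygon through `a`, read from `a⁻ → a⁺` around and back into
`a⁻`): `pturn = 5` (`W = 5π/3`: the polygon is traversed counterclockwise and the turn at `a⁻` is not counted).  Hopf
on the open sub-path from `a⁺` to `a⁻` (`c₁ = -I`, `c₂ = +I`: both endpoints on `ℓ`, the path in `{ξ ≤ 0}`) plus the
first turn `a⁻ → a⁺ → (-1,0,true)`, a left turn. [cite: Beaton2014RotatedHoneycomb, Proposition 4 (the polygon term P); DuminilCopinSmirnov2012, proof of Lemma 2 (Hopf)] -/
theorem pturn_of_isRotCloseDart {H Wd : ℕ} {P : List HV}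
    (hP : IsMidWalk ((rotStripV H Wd).erase wOut) P) (hcl : IsRotCloseDart (finalDart P)) : pturn P = 5 := by
  rcases hP.trivial_or_exists with rfl | ⟨l, u, hl, rfl⟩
  · exfalso; simp [IsRotCloseDart, finalDart, hvOrigin, wOut] at hcl
  rw [finalDart_cons_append hl] at hcl
  simp only [IsRotCloseDart] at hcl
  subst hcl
  obtain ⟨-, hh, -, hlV, hnd, hne⟩ := (isMidWalk_cons_append_iff _ hl wOut).1 hP
  have hlast := last_vertex_eq_of_close hl hP
  -- `l` has at least two vertices (else the walk would reverse `a`)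
  have h2 : 2 ≤ l.length := by
    by_contra h2
    apply hne
    cases l with
    | nil => exact absurd rfl hl
    | cons a t =>
      have ht : t = [] := List.eq_nil_of_length_eq_zero (by simp only [List.length_cons] at h2; omega)
      subst ht
      simp only [List.head?_cons, Option.some.injEq] at hh
      subst hh
      rfl
  have hv1 := second_vertex_eq hl hP h2
  -- the open sub-path `l ++ [wOut]` from `a⁺` to `a⁻`
  have hQc : (l ++ [wOut]).IsChain hvGraph.Adj := hP.1.tail
  have hwl : wOut ∉ l := fun h => (mem_erase.1 (hlV _ h)).1 rfl
  have hQnd : (l ++ [wOut]).Nodup := hnd.append (List.nodup_singleton wOut) (List.disjoint_singleton.2 hwl)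
  obtain ⟨m, hm⟩ : ∃ m, l.length = m + 1 := Nat.exists_eq_add_one_of_ne_zero (by omega)
  have hQlen : (l ++ [wOut]).length = m + 2 := by simp [hm]
  have hlξ : ∀ x ∈ l, -(H : ℤ) ≤ xi x ∧ xi x ≤ 0 := fun x hx =>
    xi_bounds_of_mem_rotStripV (mem_of_mem_erase (hlV x hx))
  -- entries of the sub-path
  have hQ0 : (l ++ [wOut]).getD 0 hvOrigin = hvOrigin := by
    cases l with
    | nil => exact absurd rfl hl
    | cons a t => simpa using hh
  have hQ1 : (l ++ [wOut]).getD 1 hvOrigin = ((-1 : ℤ), (0 : ℤ), true) := by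
    rw [getD_eq_getElem_of_lt (by simp; omega), List.getElem_append_left (by omega)]; exact hv1
  have hQm : (l ++ [wOut]).getD m hvOrigin = ((0 : ℤ), (-1 : ℤ), false) := by
    rw [getD_eq_getElem_of_lt (by simp; omega), List.getElem_append_left (by omega), ← hlast,
      List.getLast_eq_getElem]
    congr 1; omega
  have hQlast : (l ++ [wOut]).getD (m + 1) hvOrigin = wOut := by
    rw [getD_eq_getElem_of_lt (by simp; omega), List.getElem_append_right (by omega)]; simp
  have hQξ : ∀ i ≤ m + 1, xi ((l ++ [wOut]).getD i hvOrigin) ≤ 0 := by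
    intro i hi
    have hmem : (l ++ [wOut]).getD i hvOrigin ∈ l ++ [wOut] := by
      rw [getD_eq_getElem_of_lt (by omega)]; exact List.getElem_mem _
    rw [List.mem_append, List.mem_singleton] at hmem
    rcases hmem with h | h
    · exact (hlξ _ h).2
    · rw [h, xi_wOut]
  have hnI : (-I : ℂ) ≠ 0 := neg_ne_zero.2 Complex.I_ne_zero
  have key := hopf_path_eval hQc hQnd hQlen hnI Complex.I_ne_zero ?_ ?_
  · rw [hQ0, hQ1, hQm, hQlast] at key
    -- directions: first `a⁺ → (-1,0,T)` is `emb(-2,1)`, last `(0,-1,F) → a⁻` is `emb(1,1)`, chord `a⁺ → a⁻ = -e₀`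
    have e0 : edir hvOrigin wOut = -emb (-1, 2) := by
      rw [edir, pos_hvOrigin, pos_wOut, ← emb_neg]; rfl
    have e1 : edir hvOrigin ((-1 : ℤ), (0 : ℤ), true) = emb (-2, 1) := by rw [edir]; simp [pos, hvOrigin]
    have e2 : edir ((0 : ℤ), (-1 : ℤ), false) wOut = emb (1, 1) := by rw [edir]; simp [pos, wOut]
    have hD2 : Complex.arg (I * -emb (-1, 2)) = 0 := by
      rw [show I * -emb (-1, 2) = -I * emb (-1, 2) by ring, arg_negI_mul_emb_neg_one_two]
    have hD1 : Complex.arg (-I * -emb (-1, 2)) = π := by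
      rw [show -I * -emb (-1, 2) = -(-I * emb (-1, 2)) by ring, negI_mul_emb_neg_one_two, ← Complex.ofReal_neg,
        Complex.arg_ofReal_of_neg (neg_lt_zero.2 (Real.sqrt_pos.2 (by norm_num)))]
    rw [e0, e1, e2, I_mul_emb_one_one, Complex.arg_real_mul _ (by positivity), arg_omg_sq, hD2, hD1,
      arg_negI_mul_emb_neg_two_one] at key
    -- `pturn P = turn a⁻ a⁺ v₁ + pturn (l ++ [wOut])`
    have hsplit := pturn_cons wOut (l ++ [wOut]) (by omega)
    have hQ0' : (l ++ [wOut])[0]'(by omega) = hvOrigin := by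
      rw [← getD_eq_getElem_of_lt (by omega)]; exact hQ0
    have hQ1' : (l ++ [wOut])[1]'(by omega) = ((-1 : ℤ), (0 : ℤ), true) := by
      rw [← getD_eq_getElem_of_lt (by omega)]; exact hQ1
    rw [hQ0', hQ1', show turn wOut hvOrigin ((-1 : ℤ), (0 : ℤ), true) = 1 by decide] at hsplit
    have hπ : (0 : ℝ) < π / 3 := by positivity
    have : (π / 3) * (pturn (l ++ [wOut]) : ℝ) = (π / 3) * (4 : ℤ) := by push_cast; linarith
    have hq : pturn (l ++ [wOut]) = 4 := by exact_mod_cast mul_left_cancel₀ hπ.ne' this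
    rw [hsplit, hq]; rfl
  · intro i hi
    rw [hQ0, im_negI_mul_edir, xi_hvOrigin]
    have := hQξ i hi
    have : (xi ((l ++ [wOut]).getD i hvOrigin) : ℝ) ≤ 0 := by exact_mod_cast this
    nlinarith
  · intro i hi
    rw [hQlast, im_I_mul_edir, xi_wOut]
    have := hQξ i hi
    have : (xi ((l ++ [wOut]).getD i hvOrigin) : ℝ) ≤ 0 := by exact_mod_cast this
    nlinarith

/-- **Close boundary term** (the right-started half of Beaton's polygon class): `Re T = cos(7π/16) = sin(π/16)` on
the WALK weight `x^ℓ` — the repaired coefficient of record (Beaton's `c_P/2 = (2/x_c) cos(7π/16) / 2` multiplies the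
polygon weight `x^{|ρ|} = x_c · x^ℓ` instead). [cite: Beaton2014RotatedHoneycomb, Proposition 4 (c_P)] -/
theorem boundaryTerm_re_of_isRotCloseDart {H Wd : ℕ} {P : List HV}
    (hP : IsMidWalk ((rotStripV H Wd).erase wOut) P) (hcl : IsRotCloseDart (finalDart P)) :
    (edir (finalDart P).1 (finalDart P).2 * lam ^ pturn P / emb (-1, 2) * rotPhase).re = Real.cos (7 * π / 16) := by
  have hpt := pturn_of_isRotCloseDart hP hcl
  rcases hP.trivial_or_exists with rfl | ⟨l, u, hl, rfl⟩
  · exfalso; simp [IsRotCloseDart, finalDart, hvOrigin, wOut] at hcl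
  rw [finalDart_cons_append hl] at hcl ⊢
  simp only [IsRotCloseDart] at hcl
  subst hcl
  have hlast := last_vertex_eq_of_close hl hP
  dsimp only
  rw [hlast, hpt]
  obtain ⟨-, -, -, -, d40⟩ := emb_dirs_eq_lam_zpow
  have e2 : edir ((0 : ℤ), (-1 : ℤ), false) wOut = emb (1, 1) := by rw [edir]; simp [pos, wOut]
  rw [boundaryTerm_eq (a := 40) (by rw [e2, d40]), re_lam_zpow_mul_rotPhase,
    show (((40 + 5 : ℤ) : ℝ)) * θ₅ - 3 * π / 16 = 7 * π / 16 - ((5 : ℤ) : ℝ) * (2 * π) by rw [θ₅]; push_cast; ring,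
    Real.cos_sub_int_mul_two_pi]

/-- **The stub term**: the one-vertex walk `[a⁻, a⁺, (0,0,true)]` (the external half-edge below `a⁺`, weight `x_c`)
has `pturn = -1` and `Re T = cos(5π/16)`; in the identity it is moved to the right-hand side
(`cos(3π/16) - x_c cos(5π/16) = x_c cos(π/16)`, i.e. Beaton's `K = 4 x_c cos(π/16)` in the `e₀`-normalisation).
[cite: Beaton2014RotatedHoneycomb, Proposition 4 (K = 4x_c cos(π/16))] -/
theorem boundaryTerm_re_stub :
    pturn [wOut, hvOrigin, ((0 : ℤ), (0 : ℤ), true)] = -1 ∧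
    (edir hvOrigin ((0 : ℤ), (0 : ℤ), true) * lam ^ pturn [wOut, hvOrigin, ((0 : ℤ), (0 : ℤ), true)] / emb (-1, 2) *
      rotPhase).re = Real.cos (5 * π / 16) := by
  have hpt : pturn [wOut, hvOrigin, ((0 : ℤ), (0 : ℤ), true)] = -1 := by decide
  refine ⟨hpt, ?_⟩
  rw [hpt]
  obtain ⟨-, -, -, -, d40⟩ := emb_dirs_eq_lam_zpow
  have e2 : edir hvOrigin ((0 : ℤ), (0 : ℤ), true) = emb (1, 1) := by rw [edir]; simp [pos, hvOrigin]
  rw [boundaryTerm_eq (a := 40) (by rw [e2, d40]), re_lam_zpow_mul_rotPhase,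
    show (((40 + -1 : ℤ) : ℝ)) * θ₅ - 3 * π / 16 = -(5 * π / 16) - ((4 : ℤ) : ℝ) * (2 * π) by rw [θ₅]; push_cast; ring,
    Real.cos_sub_int_mul_two_pi, Real.cos_neg]

/-! ### Assembly: Beaton's Proposition 4 for `D(H, W)`, right-started walks (the lane's face K95.1) -/

section Assembly

/-- Right-started generating function of a dart class `cls` on a domain `V ∌ wOut` at `x_c`
(`Σ_{γ : finalDart ∈ cls} x_c^{ℓ(γ)}`) — text of the planner's sketch (a-idea-1, `Sketch_G16_K954.lean`), verbatim;
`rotStripBR H W` of `HexSAWRotStripDictionary` is `rotGF ((rotStripV H W).erase wOut) (IsRotTopDart H)` by `rfl`.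
[cite: Beaton2014RotatedHoneycomb, §2.2] -/
def rotGF (V : Finset HV) (cls : HV × HV → Prop) [DecidablePred cls] : ℝ :=
  ∑ P ∈ (midWalks V).filter (fun P => cls (finalDart P)), hexCriticalFugacity ^ mwLen P

/-- `rotStripBR = rotGF(top)`. [cite: Beaton2014RotatedHoneycomb, §2.2 (B_{T,L})] -/
theorem rotStripBR_eq_rotGF (H Wd : ℕ) :
    rotStripBR H Wd = rotGF ((rotStripV H Wd).erase wOut) (IsRotTopDart H) := rfl

/-- The hypotheses of `boundary_sum_rot` for `V = D(H,W) ∖ {a⁻}`: `a⁻ ∉ V`, `a⁺ ∈ V`, `ξ ≤ -1` on `V ∖ {a⁺}`.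
[cite: Beaton2014RotatedHoneycomb, §2.2 (proof of Proposition 4: the vertex set V′(D_{T,L}))] -/
theorem rotStripV_erase_hyps (H Wd : ℕ) :
    wOut ∉ (rotStripV H Wd).erase wOut ∧ hvOrigin ∈ (rotStripV H Wd).erase wOut ∧
      ∀ w ∈ (rotStripV H Wd).erase wOut, w ≠ hvOrigin → xi w ≤ -1 := by
  refine ⟨notMem_erase _ _, mem_erase.2 ⟨by decide, hvOrigin_mem_rotStripV H Wd⟩, ?_⟩
  intro w hw hne
  rw [mem_erase, mem_rotStripV_iff] at hw
  obtain ⟨hw1, h | h | ⟨h, -, -⟩⟩ := hw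
  · exact absurd h hw1
  · exact absurd h hne
  · omega

/-- **The real, normalised boundary sum of `D(H,W)`**: `Σ_{γ exits} x_c^{ℓ(γ)} · Re T(γ) = cos(3π/16)` with
`T(γ) = edir(final) · λ^{pturn γ} / e₀ · e^{-3πi/16}` (`HV.boundary_sum_rot` divided by `e₀`, times the phase, real
part). [cite: Beaton2014RotatedHoneycomb, Proposition 4 (proof: "taking real parts")] -/
theorem boundary_sum_rot_re (H Wd : ℕ) :
    ∑ P ∈ (midWalks ((rotStripV H Wd).erase wOut)).filter
        (fun P => P ≠ [wOut, hvOrigin] ∧ (finalDart P).2 ∉ (rotStripV H Wd).erase wOut),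
      hexCriticalFugacity ^ mwLen P *
        (edir (finalDart P).1 (finalDart P).2 * lam ^ pturn P / emb (-1, 2) * rotPhase).re =
      Real.cos (3 * π / 16) := by
  obtain ⟨hw, hO, hξ⟩ := rotStripV_erase_hyps H Wd
  have h := boundary_sum_rot hw hO hξ
  have e0 : edir wOut hvOrigin = emb (-1, 2) := by rw [edir, pos_hvOrigin, pos_wOut]; rfl
  rw [e0] at h
  have hne := emb_neg_one_two_ne_zero'
  have h2 : ∑ P ∈ (midWalks ((rotStripV H Wd).erase wOut)).filter
      (fun P => P ≠ [wOut, hvOrigin] ∧ (finalDart P).2 ∉ (rotStripV H Wd).erase wOut),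
      edir (finalDart P).1 (finalDart P).2 * pwt P * (rotPhase / emb (-1, 2)) = rotPhase := by
    rw [← Finset.sum_mul, h]; field_simp
  have h3 := congrArg Complex.re h2
  rw [Complex.re_sum] at h3
  have hre : rotPhase.re = Real.cos (3 * π / 16) := by
    rw [rotPhase, Complex.exp_ofReal_mul_I_re, Real.cos_neg]
  rw [hre] at h3
  rw [← h3]
  refine sum_congr rfl fun P _ => ?_
  rw [pwt, show edir (finalDart P).1 (finalDart P).2 * ((hexCriticalFugacity : ℂ) ^ mwLen P * lam ^ pturn P) *
      (rotPhase / emb (-1, 2)) = ((hexCriticalFugacity ^ mwLen P : ℝ) : ℂ) *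
      (edir (finalDart P).1 (finalDart P).2 * lam ^ pturn P / emb (-1, 2) * rotPhase) by push_cast; ring,
    Complex.re_ofReal_mul]

/-- A right-started walk of `D(H,W) ∖ {a⁻}` whose final half-edge is the stub below `a⁺` IS the one-vertex stub walk
`[a⁻, a⁺, (0,0,true)]` (self-avoidance: `a⁺` is the first inner vertex). [cite: Beaton2014RotatedHoneycomb, §2.2] -/
theorem eq_stubWalk_of_isRotStubDart {H Wd : ℕ} {P : List HV}
    (hP : IsMidWalk ((rotStripV H Wd).erase wOut) P) (hst : IsRotStubDart (finalDart P)) :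
    P = [wOut, hvOrigin, ((0 : ℤ), (0 : ℤ), true)] := by
  rcases hP.trivial_or_exists with rfl | ⟨l, u, hl, rfl⟩
  · exfalso; simp [IsRotStubDart, finalDart, hvOrigin, wOut] at hst
  rw [finalDart_cons_append hl] at hst
  simp only [IsRotStubDart, Prod.mk.injEq] at hst
  obtain ⟨hv, rfl⟩ := hst
  obtain ⟨-, hh, -, -, hnd, -⟩ := (isMidWalk_cons_append_iff _ hl _).1 hP
  have h0 : l[0]'(List.length_pos_of_ne_nil hl) = hvOrigin := by
    cases l with
    | nil => exact absurd rfl hl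
    | cons a t => simpa using hh
  have hlast : l[l.length - 1]'(by have := List.length_pos_of_ne_nil hl; omega) = hvOrigin := by
    rw [← hv, List.getLast_eq_getElem]
  have hlen : l.length - 1 = 0 := (List.Nodup.getElem_inj_iff hnd).1 (hlast.trans h0.symm)
  cases l with
  | nil => exact absurd rfl hl
  | cons a t =>
    have ht : t = [] := List.eq_nil_of_length_eq_zero (by simpa using hlen)
    subst ht
    simp only [List.head?_cons, Option.some.injEq] at hh
    subst hh
    rfl

/-- The stub walk is a right-started walk of `D(H,W) ∖ {a⁻}`. [cite: Beaton2014RotatedHoneycomb, §2.2] -/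
theorem stubWalk_isMidWalk (H Wd : ℕ) :
    IsMidWalk ((rotStripV H Wd).erase wOut) [wOut, hvOrigin, ((0 : ℤ), (0 : ℤ), true)] := by
  rw [show [wOut, hvOrigin, ((0 : ℤ), (0 : ℤ), true)] = wOut :: ([hvOrigin] ++ [((0 : ℤ), (0 : ℤ), true)]) from rfl,
    isMidWalk_cons_append_iff _ (List.cons_ne_nil _ _)]
  refine ⟨List.isChain_singleton _, rfl, ?_, ?_, List.nodup_singleton _, by decide⟩
  · rw [List.getLast_singleton, hvGraph_adj]; simp [AdjRel, hvOrigin]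
  · intro x hx
    rw [List.mem_singleton] at hx
    subst hx
    exact (rotStripV_erase_hyps H Wd).2.1

/-- The stub class consists of the stub walk alone. [cite: Beaton2014RotatedHoneycomb, §2.2] -/
theorem filter_isRotStubDart (H Wd : ℕ) :
    (midWalks ((rotStripV H Wd).erase wOut)).filter (fun P => IsRotStubDart (finalDart P)) =
      {[wOut, hvOrigin, ((0 : ℤ), (0 : ℤ), true)]} := by
  ext P
  simp only [mem_filter, mem_singleton, mem_midWalks_iff]
  constructor
  · rintro ⟨hP, hst⟩; exact eq_stubWalk_of_isRotStubDart hP hst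
  · rintro rfl; exact ⟨stubWalk_isMidWalk H Wd, rfl⟩

/-- Walks that do not exit (the trivial walk, or a final half-edge inside `V`) are in no class.
[cite: Beaton2014RotatedHoneycomb, §2.2] -/
theorem no_class_of_not_exit {H Wd : ℕ} (hH : 1 ≤ H) {P : List HV}
    (hP : IsMidWalk ((rotStripV H Wd).erase wOut) P)
    (h : ¬ (P ≠ [wOut, hvOrigin] ∧ (finalDart P).2 ∉ (rotStripV H Wd).erase wOut)) :
    ¬ IsRotBotIn (finalDart P) ∧ ¬ IsRotBotOut (finalDart P) ∧ ¬ IsRotLatDart H Wd (finalDart P) ∧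
      ¬ IsRotTopDart H (finalDart P) ∧ ¬ IsRotCloseDart (finalDart P) ∧ ¬ IsRotStubDart (finalDart P) := by
  rcases not_and_or.1 h with h | h
  · have ht : P = [wOut, hvOrigin] := not_ne_iff.1 h
    subst ht
    rw [finalDart_trivial]
    refine ⟨?_, ?_, ?_, ?_, ?_, ?_⟩
    · simp [IsRotBotIn, IsRotBotDart, xi_wOut]
    · simp [IsRotBotOut, IsRotBotDart, xi_wOut]
    · simp [IsRotLatDart, xi_wOut]
    · simp only [IsRotTopDart, xi_wOut, xi_hvOrigin]; omega
    · simp [IsRotCloseDart, hvOrigin, wOut]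
    · simp [IsRotStubDart, hvOrigin, wOut]
  · have hw : (finalDart P).2 ∈ (rotStripV H Wd).erase wOut := not_not.1 h
    have hnc := fun hcls => not_mem_of_class (Wd := Wd) (v := (finalDart P).1) (w := (finalDart P).2) hH hcls hw
    refine ⟨fun h1 => hnc (Or.inl h1), fun h2 => hnc (Or.inr (Or.inl h2)),
      fun h3 => hnc (Or.inr (Or.inr (Or.inl h3))), fun h4 => hnc (Or.inr (Or.inr (Or.inr (Or.inl h4)))),
      fun h5 => hnc (Or.inr (Or.inr (Or.inr (Or.inr (Or.inl h5))))),
      fun h6 => hnc (Or.inr (Or.inr (Or.inr (Or.inr (Or.inr h6)))))⟩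

/-- **Sorting one exit term into its class** (completeness + disjointness of the six classes, and the boundary-term
real part per class): for a right-started walk `P` of `D(H,W) ∖ {a⁻}`, `[P exits] · x_c^ℓ · Re T(P)` equals the sum over
the classes of `[finalDart P ∈ class] · x_c^ℓ · c_class` with `c = cos(π/16), cos(3π/16), cos(5π/16), cos(7π/16), cos(7π/16),
cos(5π/16)` for top, lateral, `α^O`, `α^I`, close, stub. [cite: Beaton2014RotatedHoneycomb, Proposition 4 (proof)] -/
theorem exitTerm_eq_classTerms {H Wd : ℕ} (hH : 1 ≤ H) (hW : 1 ≤ Wd) {P : List HV}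
    (hP : IsMidWalk ((rotStripV H Wd).erase wOut) P) :
    (if P ≠ [wOut, hvOrigin] ∧ (finalDart P).2 ∉ (rotStripV H Wd).erase wOut then
        hexCriticalFugacity ^ mwLen P *
          (edir (finalDart P).1 (finalDart P).2 * lam ^ pturn P / emb (-1, 2) * rotPhase).re
      else 0) =
      (if IsRotTopDart H (finalDart P) then hexCriticalFugacity ^ mwLen P * Real.cos (π / 16) else 0) +
      (if IsRotLatDart H Wd (finalDart P) then hexCriticalFugacity ^ mwLen P * Real.cos (3 * π / 16) else 0) +
      (if IsRotBotOut (finalDart P) then hexCriticalFugacity ^ mwLen P * Real.cos (5 * π / 16) else 0) +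
      (if IsRotBotIn (finalDart P) then hexCriticalFugacity ^ mwLen P * Real.cos (7 * π / 16) else 0) +
      (if IsRotCloseDart (finalDart P) then hexCriticalFugacity ^ mwLen P * Real.cos (7 * π / 16) else 0) +
      (if IsRotStubDart (finalDart P) then hexCriticalFugacity ^ mwLen P * Real.cos (5 * π / 16) else 0) := by
  by_cases hq : P ≠ [wOut, hvOrigin] ∧ (finalDart P).2 ∉ (rotStripV H Wd).erase wOut
  · rw [if_pos hq]
    obtain ⟨hne, hw⟩ := hq
    have hv : (finalDart P).1 ∈ (rotStripV H Wd).erase wOut := finalDart_fst_mem hP hne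
    have hcls := rotStrip_exit_classes hH hW hv hP.adj_finalDart hw
    obtain ⟨d1, d2, d3, d4, d5, d6, d7, d8, d9, d10, d11⟩ :=
      rotStrip_classes_disjoint (Wd := Wd) hH (finalDart P).1 (finalDart P).2
    rcases hcls with h | h | h | h | h | h
    · -- `α^I`
      have hb : IsRotBotDart (finalDart P) := h.1
      rw [boundaryTerm_re_of_isRotBotIn hP h, if_neg (d3 hb), if_neg (d2 hb), if_neg (d1 h), if_pos h,
        if_neg (d4 hb), if_neg (d5 hb)]
      ring
    · -- `α^O`
      have hb : IsRotBotDart (finalDart P) := h.1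
      have hni : ¬ IsRotBotIn (finalDart P) := fun h' => d1 h' h
      rw [boundaryTerm_re_of_isRotBotOut hP h, if_neg (d3 hb), if_neg (d2 hb), if_pos h, if_neg hni,
        if_neg (d4 hb), if_neg (d5 hb)]
      ring
    · -- `ε`
      have hnb : ¬ IsRotBotDart (finalDart P) := fun h' => d2 h' h
      rw [boundaryTerm_re_of_isRotLatDart hW hP h, if_neg (d6 h), if_pos h, if_neg (fun h' => hnb h'.1),
        if_neg (fun h' => hnb h'.1), if_neg (d7 h), if_neg (d8 h)]
      ring
    · -- `β`
      have hnb : ¬ IsRotBotDart (finalDart P) := fun h' => d3 h' h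
      have hnl : ¬ IsRotLatDart H Wd (finalDart P) := fun h' => d6 h' h
      rw [boundaryTerm_re_of_isRotTopDart hH hP h, if_pos h, if_neg hnl, if_neg (fun h' => hnb h'.1),
        if_neg (fun h' => hnb h'.1), if_neg (d9 h), if_neg (d10 h)]
      ring
    · -- close
      have hnb : ¬ IsRotBotDart (finalDart P) := fun h' => d4 h' h
      have hnl : ¬ IsRotLatDart H Wd (finalDart P) := fun h' => d7 h' h
      have hnt : ¬ IsRotTopDart H (finalDart P) := fun h' => d9 h' h
      rw [boundaryTerm_re_of_isRotCloseDart hP h, if_neg hnt, if_neg hnl, if_neg (fun h' => hnb h'.1),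
        if_neg (fun h' => hnb h'.1), if_pos h, if_neg (d11 h)]
      ring
    · -- stub
      have hnb : ¬ IsRotBotDart (finalDart P) := fun h' => d5 h' h
      have hnl : ¬ IsRotLatDart H Wd (finalDart P) := fun h' => d8 h' h
      have hnt : ¬ IsRotTopDart H (finalDart P) := fun h' => d10 h' h
      have hnc : ¬ IsRotCloseDart (finalDart P) := fun h' => d11 h' h
      rw [if_neg hnt, if_neg hnl, if_neg (fun h' => hnb h'.1), if_neg (fun h' => hnb h'.1), if_neg hnc, if_pos h]
      have hP' := eq_stubWalk_of_isRotStubDart hP h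
      subst hP'
      have hfd : finalDart [wOut, hvOrigin, ((0 : ℤ), (0 : ℤ), true)] = (hvOrigin, ((0 : ℤ), (0 : ℤ), true)) := rfl
      rw [hfd]
      dsimp only
      rw [boundaryTerm_re_stub.2]
      ring
  · rw [if_neg hq]
    obtain ⟨h1, h2, h3, h4, h5, h6⟩ := no_class_of_not_exit hH hP hq
    rw [if_neg h1, if_neg h2, if_neg h3, if_neg h4, if_neg h5, if_neg h6]
    ring

/-- `2 x_c cos(π/8) = 1` (`x_c = 1/√(2+√2)`, `cos(π/8) = √(2+√2)/2`). [cite: DuminilCopinSmirnov2012, §1 (x_c = 1/√(2+√2) = 1/(2cos(π/8)))] -/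
theorem two_mul_hexCriticalFugacity_mul_cos_pi_div_eight : 2 * hexCriticalFugacity * Real.cos (π / 8) = 1 := by
  have hne : Real.sqrt (2 + Real.sqrt 2) ≠ 0 := by positivity
  rw [hexCriticalFugacity, Real.cos_pi_div_eight]
  field_simp

/-- **Beaton's Proposition 4 for the rotated strip `D(H, W)`, right-started normalisation** (the lane's face K95.1
«ROT-STRIP-IDENTITY», repaired edition): for all `H, W ≥ 1`, with `V = D(H,W) ∖ {a⁻}` and the GFs at `x = x_c` weighted by
`x_c^{ℓ}` (`ℓ` = vertices of the walk, `a⁻` not counted),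
`2 sin(3π/16) A^O + 2 sin(π/16) A^I + 2 cos(3π/16) E + 2 cos(π/16) B + 2 cos(7π/16) P = 2 x_c cos(π/16)`
— Beaton's `c_O A^O + c_I A^I + c_E E + c_B B + c_P P = K` for right-started walks (half of each both-starts class; the
polygon class with `(c_P/2) · x_c = 2cos(7π/16)` because `P` here omits the vertex `a⁻`; `K/2 = 2 x_c cos(π/16)`, the stub
walk's `x_c cos(5π/16)` having been moved to the right: `cos(3π/16) - x_c cos(5π/16) = x_c cos(π/16)`).  Proof: the rotated
boundary sum `HV.boundary_sum_rot` (the tree's vertex relation needs no winding around the cell right of `a`, which holds in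
`{ξ ≤ 0}`), its terms sorted by `rotStrip_exit_iff` into the six classes, the winding per class by Hopf
(`pturn_of_isRot*Dart`), real parts after the phase `e^{-3πi/16}`. [cite: Beaton2014RotatedHoneycomb, §2.2, Proposition 4 (arXiv v3 p. 5) and its proof (pp. 5–7); Lemma 3 (§2.1, p. 4)] [cite: DuminilCopinSmirnov2012, Lemma 1 and proof of Lemma 2 (Hopf)] -/
theorem rotStrip_identity {H Wd : ℕ} (hH : 1 ≤ H) (hW : 1 ≤ Wd) :
    2 * Real.sin (3 * Real.pi / 16) * rotGF ((rotStripV H Wd).erase wOut) IsRotBotOut +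
      2 * Real.sin (Real.pi / 16) * rotGF ((rotStripV H Wd).erase wOut) IsRotBotIn +
      2 * Real.cos (3 * Real.pi / 16) * rotGF ((rotStripV H Wd).erase wOut) (IsRotLatDart H Wd) +
      2 * Real.cos (Real.pi / 16) * rotGF ((rotStripV H Wd).erase wOut) (IsRotTopDart H) +
      2 * Real.cos (7 * Real.pi / 16) * rotGF ((rotStripV H Wd).erase wOut) IsRotCloseDart =
    2 * hexCriticalFugacity * Real.cos (Real.pi / 16) := by
  have hsum := boundary_sum_rot_re H Wd
  rw [sum_filter, sum_congr rfl (fun P hP => exitTerm_eq_classTerms hH hW (mem_midWalks_iff.1 hP))] at hsum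
  simp only [sum_add_distrib] at hsum
  have hcls : ∀ (cls : HV × HV → Prop) [DecidablePred cls] (c : ℝ),
      ∑ P ∈ midWalks ((rotStripV H Wd).erase wOut),
        (if cls (finalDart P) then hexCriticalFugacity ^ mwLen P * c else 0) =
        c * rotGF ((rotStripV H Wd).erase wOut) cls := by
    intro cls _ c
    rw [rotGF, mul_sum, sum_filter]
    refine sum_congr rfl fun P _ => ?_
    split_ifs <;> ring
  have hstub : ∑ P ∈ midWalks ((rotStripV H Wd).erase wOut),
      (if IsRotStubDart (finalDart P) then hexCriticalFugacity ^ mwLen P * Real.cos (5 * π / 16) else 0) =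
      hexCriticalFugacity * Real.cos (5 * π / 16) := by
    rw [← sum_filter, filter_isRotStubDart, sum_singleton]
    simp [mwLen]
  rw [hcls, hcls, hcls, hcls, hcls, hstub] at hsum
  have hs3 : Real.sin (3 * π / 16) = Real.cos (5 * π / 16) := by
    rw [← Real.cos_pi_div_two_sub]; congr 1; ring
  have hs1 : Real.sin (π / 16) = Real.cos (7 * π / 16) := by
    rw [← Real.cos_pi_div_two_sub]; congr 1; ring
  have hK : Real.cos (3 * π / 16) = hexCriticalFugacity * (Real.cos (π / 16) + Real.cos (5 * π / 16)) := by
    rw [Real.cos_add_cos, show (π / 16 + 5 * π / 16) / 2 = 3 * π / 16 by ring,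
      show (π / 16 - 5 * π / 16) / 2 = -(π / 8) by ring, Real.cos_neg]
    linear_combination (-Real.cos (3 * π / 16)) * two_mul_hexCriticalFugacity_mul_cos_pi_div_eight
  rw [hs3, hs1]
  linear_combination 2 * hsum + 2 * hK

/-- The face K95.1 in the planner's `∀ H W` form. [cite: Beaton2014RotatedHoneycomb, §2.2, Proposition 4 (arXiv v3 p. 5) and its proof (pp. 5–7)] -/
theorem rotStrip_identity_all :
    ∀ H Wd : ℕ, 1 ≤ H → 1 ≤ Wd →
      let V := (rotStripV H Wd).erase wOut
      2 * Real.sin (3 * Real.pi / 16) * rotGF V IsRotBotOut + 2 * Real.sin (Real.pi / 16) * rotGF V IsRotBotIn +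
        2 * Real.cos (3 * Real.pi / 16) * rotGF V (IsRotLatDart H Wd) + 2 * Real.cos (Real.pi / 16) * rotGF V (IsRotTopDart H) +
        2 * Real.cos (7 * Real.pi / 16) * rotGF V IsRotCloseDart =
      2 * hexCriticalFugacity * Real.cos (Real.pi / 16) :=
  fun _ _ hH hW => rotStrip_identity hH hW

/-- **Corollary (Beaton's bridge bound, eq. after Proposition 4)**: `B^{⊥,→}(H, W) ≤ x_c` — indeed
`2cos(π/16) · rotStripBR H W ≤ 2 x_c cos(π/16)`, all other classes being nonnegative. [cite: Beaton2014RotatedHoneycomb, §4 (arXiv v3 pp. 16–17: "every term … is non-negative", "bounded by this identity")] [cite: DuminilCopinSmirnov2012, §3 (B_T^{x_c} ≤ 1)] -/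
theorem rotStripBR_le_hexCriticalFugacity {H Wd : ℕ} (hH : 1 ≤ H) (hW : 1 ≤ Wd) :
    rotStripBR H Wd ≤ hexCriticalFugacity := by
  have h := rotStrip_identity hH hW
  rw [← rotStripBR_eq_rotGF] at h
  have hnn : ∀ (cls : HV × HV → Prop) [DecidablePred cls], 0 ≤ rotGF ((rotStripV H Wd).erase wOut) cls :=
    fun cls _ => sum_nonneg fun _ _ => pow_nonneg hexCriticalFugacity_pos_lt_one.1.le _
  have c1 : 0 < Real.cos (Real.pi / 16) := Real.cos_pos_of_mem_Ioo ⟨by linarith [Real.pi_pos], by linarith [Real.pi_pos]⟩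
  have c3 : 0 ≤ Real.cos (3 * Real.pi / 16) := Real.cos_nonneg_of_mem_Icc ⟨by linarith [Real.pi_pos], by linarith [Real.pi_pos]⟩
  have c7 : 0 ≤ Real.cos (7 * Real.pi / 16) := Real.cos_nonneg_of_mem_Icc ⟨by linarith [Real.pi_pos], by linarith [Real.pi_pos]⟩
  have s1 : 0 ≤ Real.sin (Real.pi / 16) := Real.sin_nonneg_of_nonneg_of_le_pi (by positivity) (by linarith [Real.pi_pos])
  have s3 : 0 ≤ Real.sin (3 * Real.pi / 16) := Real.sin_nonneg_of_nonneg_of_le_pi (by positivity) (by linarith [Real.pi_pos])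
  nlinarith [hnn IsRotBotOut, hnn IsRotBotIn, hnn (IsRotLatDart H Wd), hnn IsRotCloseDart,
    mul_nonneg s3 (hnn IsRotBotOut), mul_nonneg s1 (hnn IsRotBotIn), mul_nonneg c3 (hnn (IsRotLatDart H Wd)),
    mul_nonneg c7 (hnn IsRotCloseDart), rotStripBR_nonneg H Wd]

end Assembly

end HV

end Literature.Probability.RandomPlanarGeometry.SAW
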